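import Literature.Analysis.FluidPDE.LocalEnstrophyBalance
import Literature.Analysis.FluidPDE.GrujicGuberovic2010LocalHybridCriteria
import Literature.Analysis.FluidPDE.GrujicRuzmaikina2004HybridDirectionCriterionHolds
import Literature.Analysis.FluidPDE.SereginZajaczkowski2007L42Vorticity
import HarnessLib

/-!
# Grujić–Guberović 2010, Theorem 2 — PROVED (discharge of the named fact
# `grujicGuberovic2010_coherenceWeighted_criterion`)

Analysis/FluidPDE proof file (theorems only: no definition, no named fact, no `sorry`): the
discharge `grujicGuberovic2010_coherenceWeighted_criterion_holds` of the named fact vendored in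
`GrujicGuberovic2010LocalHybridCriteria.lean` (Z. Grujić, R. Guberović, *Localization of analytic
regularity criteria on the vorticity and balance between the vorticity magnitude and coherence of
the vorticity direction in the 3D NSE*, Comm. Math. Phys. **298** (2010) 407–418, **Theorem 2**,
p. 415: a Leray–Hopf solution smooth on `(t₀ − (2R)², t₀) × B(x₀, 4R)` whose vorticity magnitude,
WEIGHTED by the `γ`-Hölder measure of coherence of the vorticity direction
`ρ_{γ,2R}(x,t) = sup_{y ∈ B(x,2R), y ≠ x} |sin φ(ξ(x,t), ξ(y,t))|/|x − y|^γ`, lies in the critical class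
`∫_{t₀−(2R)²}^{t₀} (∫_{B(x₀,2R)} |ω|^α ρ_{γ,2R}^α dx)^δ dt < ∞`, `0 < γ < 1`, `3/(γ+2) < α < 3/γ`,
`δ = 2/((2+γ)α − 3)`, has `sup_{t ∈ (t₀−R², t₀)} ∫_{B(x₀,R)} |ω|² < ∞`).

## Proof (the printed chain, pp. 415–417, in the pointwise-in-time Grönwall/covering form of the
## tree's discharges of Grujić 2009 Thm. 1, Grujić–Zhang 2006 Thms. 1.1–1.2, Grujić–Guberović Thm. 1)

The printed proof bounds the leading vortex-stretching term by (14),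
`J ≤ c ∫∫ ρ_{γ,2r}(x,t)|ω(x,t)| (∫ |ψω(y,t)|/|x − y|^{3−γ} dy) |ψω(x,t)| dx dt`, and then uses
"Hölder inequality in `x` with the exponents `α, p₁` and `p₂` … the Hardy–Littlewood–Sobolev
inequality … Interpolating the last two factors" (pp. 416–417). Since the quotient
`|sin φ(ξ(x), ξ(y))|/|x − y|^γ` is symmetric in `x, y`, the depletion is equally dominated by the
coherence measure at the CONVOLUTION point `y`; in that form the weight `ρ_{γ,2R}|ω|` is the density
of the Riesz potential and the printed Hölder/HLS/interpolation chain is literally the tree's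
localized hybrid stretching estimate on Chae's scaling line with (Hölder, Lebesgue) exponents
`(γ, α)`, `θ = 1 + γ/2 − 3/(2α)`, `1/(αθ) = δ`:
* `exists_localized_stretching_le_of_holderWeight_Lr` (`LocalizedHybridDirectionStretching.lean`)
  and the balance `IsLerayHopfOn.exists_weight_localEnstrophy_deriv_le_holderWeight`
  (`LocalEnstrophyBalance.lean`) on every ball `B(c, 6s)`, `s = R/16`, `c ∈ B̄(x₀, R)`
  (`B̄(c, 12s) ⊆ B(x₀, 4R)`, `B(c, 6s) ⊆ B(x₀, 2R)`, and `|x − y| < 12s < 2R` for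
  `x, y ∈ B(c, 6s)`, so `|sin φ(ξ(x,t), ξ(y,t))| ≤ ρ_{γ,2R}(y,t)|x − y|^γ` by the definition of
  the supremum), with the Grönwall weight
  `(∫_{B̄(c,6s)} (ρ_{γ,2R}|ω|)^α)^δ ≤ (∫_{B(x₀,2R)} |ω|^α ρ_{γ,2R}^α)^δ`;
* the slice `x ↦ ρ_{γ,2R}(x,t)` is lower semicontinuous on `B(x₀, 2R)` (a supremum of quotients
  each of which is continuous at the points where it is positive), hence measurable, and
  `ρ_{γ,2R}(x,t) ≤ max (2L(t)R^{1−γ}/|ω(x,t)|, R^{−γ})` with `L(t)` a Lipschitz constant of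
  `ω(t)` on `B(x₀, 3R)` (`|ξ(x) × ξ(y)| ≤ |ξ(y) − ξ(x)| ≤ 2|ω(y) − ω(x)|/|ω(x)|`), so the weight is
  bounded on the high-vorticity points of each slice;
* the Leray–Hopf structure: `∫_{B̄}|u(t)|² ≤ 2E(u₀)` and `∫_I ∫_{B̄(c,6s)}‖∇u‖² < ∞`;
* Grönwall's inequality in the measurability-free lower-integral form
  `SereginZajaczkowski2007.lintegral_gronwall_le_of_Icc` on `[t₀ − 2R², τ]`, uniformly in `τ < t₀`
  (the weight `t ↦ (∫ (ρ_{γ,2R}|ω|)^α)^δ` is only lower semicontinuous) — this replaces the printed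
  space–time Hölder inequality and absorption for small `r` (recorded deviation) — and a finite
  cover of `B̄(x₀, R)` by balls `B(c, s/2)` on which the weights are `≡ 1`.
The hypothesis `R < 1` is not used; the threshold of the high/low vorticity splitting is `|ω| = 1`.
`grujicGuberovic2010_coherenceWeighted_criterion_of_smooth_Q2R` is the same theorem under the
PRINTED smoothness hypothesis (`u` smooth on `Q_{2R}(x₀, t₀) = (t₀ − (2R)², t₀) × B(x₀, 2R)` only;
the proof pairs points at distance `< R/4` inside `B(x₀, 7R/4)`), closing the `TODO(general form)`
recorded at the fact.

No regularity claim about Navier–Stokes is made beyond the printed theorem.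

## References

* Z. Grujić, R. Guberović, Comm. Math. Phys. 298 (2010) 407–418, (5)–(7) (p. 410), Thm. 2 (p. 415)
  and its proof (13)–(14), pp. 415–417. [GrujicGuberovic2010]
* Z. Grujić, Comm. Math. Phys. 290 (2009) 861–870, Thm. 1 (tree theorem
  `grujic2009_localized_halfHolder_coherence_holds`). [Grujic2009]
* Z. Grujić, Qi S. Zhang, Comm. Math. Phys. 262 (2006) 555–564, Thm. 1.1 (tree theorem
  `grujicZhang2006_localized_hybrid_coherence_holds`). [GrujicZhang2006]
* J. C. Robinson, J. L. Rodrigo, W. Sadowski, *The Three-Dimensional Navier–Stokes Equations*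
  (2016), Lemma A.25 (Grönwall with an `L¹` kernel). [RobinsonRodrigoSadowski2016]
-/

noncomputable section

open MeasureTheory TopologicalSpace Set Function Filter Metric Real InnerProductSpace
open _root_.Topology
open scoped ENNReal NNReal RealInnerProductSpace ContDiff

namespace Literature.Analysis.FluidPDE

/-! ### Private helpers (copies of the private helpers of
`GrujicGuberovic2010LocalizedVorticityCriterionHolds`) -/

/-- A weak derivative only depends on the values of `f` on `Ω`. [folklore] -/
private theorem hasWeakFDerivOn_congr_left_cw {Ω : Opens (EuclideanSpace ℝ (Fin 3))}
    {f f' : (EuclideanSpace ℝ (Fin 3)) → (EuclideanSpace ℝ (Fin 3))}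
    {g : (EuclideanSpace ℝ (Fin 3)) → (EuclideanSpace ℝ (Fin 3)) →L[ℝ] (EuclideanSpace ℝ (Fin 3))}
    (h : FunctionSpaces.HasWeakFDerivOn Ω volume f g) (hf : Set.EqOn f' f Ω) :
    FunctionSpaces.HasWeakFDerivOn Ω volume f' g where
  locallyIntegrableOn := h.locallyIntegrableOn.congr
    (ae_restrict_of_forall_mem Ω.isOpen.measurableSet fun x hx => (hf hx).symm)
  locallyIntegrableOn_deriv := h.locallyIntegrableOn_deriv
  integral_fderiv_smul_eq φ v hφ := by
    rw [setIntegral_congr_fun Ω.isOpen.measurableSet (fun x hx => by rw [hf hx])]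
    exact h.integral_fderiv_smul_eq φ v hφ

/-- `x ↦ φ(x)² h(x)` is continuous on the whole space when `h` is continuous on an open set
containing the support of the continuous weight `φ`. [folklore] -/
private theorem continuous_sq_mul_of_continuousOn_cw {φ h : (EuclideanSpace ℝ (Fin 3)) → ℝ}
    {S : Set (EuclideanSpace ℝ (Fin 3))} (hS : IsOpen S) (hφ : Continuous φ) (hφS : tsupport φ ⊆ S)
    (hh : ContinuousOn h S) : Continuous fun x => φ x ^ 2 * h x := by
  refine continuous_iff_continuousAt.2 fun x => ?_
  by_cases hx : x ∈ S
  · exact (hφ.continuousAt.pow 2).mul (hh.continuousAt (hS.mem_nhds hx))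
  · have hφ0 : φ =ᶠ[𝓝 x] 0 := notMem_tsupport_iff_eventuallyEq.1 fun h => hx (hφS h)
    have hev : (fun _ => (0 : ℝ)) =ᶠ[𝓝 x] fun y => φ y ^ 2 * h y := by
      filter_upwards [hφ0] with y hy
      rw [hy, Pi.zero_apply]; ring
    exact continuousAt_const.congr hev

/-- **The local dissipation of a Leray–Hopf solution is integrable in time on a region of
smoothness**: for `B̄(c, r) ⊆ S` and `u` jointly `C^∞` on `I × S` (`I ⊆ (0,T)`), the continuous
function `t ↦ ∫_{B̄(c,r)} ‖∇u(t)‖²` is integrable on `I`. [folklore] -/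
private theorem IsLerayHopfOn.integrableOn_localGradSq_cw {T ν : ℝ}
    {u₀ : (EuclideanSpace ℝ (Fin 3)) → (EuclideanSpace ℝ (Fin 3))}
    {u : ℝ → (EuclideanSpace ℝ (Fin 3)) → (EuclideanSpace ℝ (Fin 3))}
    (hLH : IsLerayHopfOn T ν 0 u₀ u) {I : Set ℝ} {S : Set (EuclideanSpace ℝ (Fin 3))}
    (hI : IsOpen I) (hS : IsOpen S) (hIT : I ⊆ Ioo 0 T)
    (hu : ContDiffOn ℝ ∞ (uncurry u) (I ×ˢ S)) {c : (EuclideanSpace ℝ (Fin 3))} {r : ℝ}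
    (hcS : closedBall c r ⊆ S)
    (hF : ContinuousOn (fun t => ∫ x in closedBall c r, ‖fderiv ℝ (u t) x‖ ^ 2) I) :
    IntegrableOn (fun t => ∫ x in closedBall c r, ‖fderiv ℝ (u t) x‖ ^ 2) I := by
  obtain ⟨G, hGae, hGfin, -, -⟩ := hLH.weakGrad_energy
  obtain ⟨-, -, hDU, -, -, -, -⟩ := hLH.vorticity_classical_of_contDiffOn hI hS hIT hu
  have hImeas : MeasurableSet I := hI.measurableSet
  refine ⟨hF.aestronglyMeasurable hImeas, ?_⟩
  have hbound : ∀ᵐ t ∂((volume : Measure ℝ).restrict I),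
      ENNReal.ofReal (∫ x in closedBall c r, ‖fderiv ℝ (u t) x‖ ^ 2) ≤
        ∫⁻ x, ENNReal.ofReal (frobeniusNormSq (G t x)) := by
    have h1 : ∀ᵐ t ∂((volume : Measure ℝ).restrict I), HasWeakGradient (u t) (G t) :=
      ae_restrict_of_ae_restrict_of_subset hIT hGae
    have h2 : ∀ᵐ t ∂((volume : Measure ℝ).restrict I), t ∈ I := ae_restrict_mem hImeas
    filter_upwards [h1, h2] with t hGt ht
    have hut : ContDiffOn ℝ ∞ (u t) S := by
      have h : ContDiffOn ℝ ∞ (fun x : (EuclideanSpace ℝ (Fin 3)) => ((t, x) : ℝ × (EuclideanSpace ℝ (Fin 3)))) S :=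
        contDiffOn_const.prodMk contDiffOn_id
      exact hu.comp h fun x hx => ⟨ht, hx⟩
    obtain ⟨V, hV, N, hNo, hKN, hNS, hVu⟩ :=
      ContDiffOn.exists_contDiff_eqOn_nhds_of_isCompact hut hS (isCompact_closedBall c r) hcS
    have hV1 : ContDiff ℝ 1 V := hV.of_le (by exact_mod_cast le_top)
    have hDVeq : ∀ x ∈ N, fderiv ℝ V x = fderiv ℝ (u t) x := fun x hx =>
      (eventuallyEq_of_mem (hNo.mem_nhds hx) hVu).fderiv_eq
    have hW1 : FunctionSpaces.HasWeakFDerivOn ⟨N, hNo⟩ volume (u t) (G t) :=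
      FunctionSpaces.HasWeakFDerivOn.mono_set_holds hGt le_top
    have hW2 : FunctionSpaces.HasWeakFDerivOn ⟨N, hNo⟩ volume (u t) (fderiv ℝ V) :=
      hasWeakFDerivOn_congr_left_cw (FunctionSpaces.HasWeakFDerivOn.of_contDiff_holds ⟨N, hNo⟩ volume hV1)
        fun x hx => (hVu hx).symm
    have hae : G t =ᵐ[volume.restrict N] fderiv ℝ V := FunctionSpaces.HasWeakFDerivOn.unique_holds hW1 hW2
    have hae' : ∀ᵐ x ∂(volume.restrict (closedBall c r)),
        ENNReal.ofReal (frobeniusNormSq (fderiv ℝ (u t) x)) = ENNReal.ofReal (frobeniusNormSq (G t x)) := by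
      have h := ae_restrict_of_ae_restrict_of_subset hKN hae
      have hm : ∀ᵐ x ∂(volume.restrict (closedBall c r)), x ∈ closedBall c r :=
        ae_restrict_mem measurableSet_closedBall
      filter_upwards [h, hm] with x hx hxm
      rw [hx, hDVeq x (hKN hxm)]
    have hcont : ContinuousOn (fun x => ‖fderiv ℝ (u t) x‖ ^ 2) (closedBall c r) := by
      have hc : Continuous (fun x : (EuclideanSpace ℝ (Fin 3)) => ((t, x) : ℝ × (EuclideanSpace ℝ (Fin 3)))) :=
        continuous_const.prodMk continuous_id
      exact ((hDU.comp hc.continuousOn fun x hx => ⟨ht, hcS hx⟩).norm).pow 2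
    have hint : IntegrableOn (fun x => ‖fderiv ℝ (u t) x‖ ^ 2) (closedBall c r) :=
      hcont.integrableOn_compact (isCompact_closedBall c r)
    rw [ofReal_integral_eq_lintegral_ofReal hint (ae_of_all _ fun x => by positivity)]
    calc ∫⁻ x in closedBall c r, ENNReal.ofReal (‖fderiv ℝ (u t) x‖ ^ 2)
        ≤ ∫⁻ x in closedBall c r, ENNReal.ofReal (frobeniusNormSq (fderiv ℝ (u t) x)) :=
          lintegral_mono fun x => ENNReal.ofReal_le_ofReal (sq_opNorm_le_frobeniusNormSq _)
      _ = ∫⁻ x in closedBall c r, ENNReal.ofReal (frobeniusNormSq (G t x)) := lintegral_congr_ae hae'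
      _ ≤ ∫⁻ x, ENNReal.ofReal (frobeniusNormSq (G t x)) := setLIntegral_le_lintegral _ _
  have hle : ∫⁻ t in I, ‖∫ x in closedBall c r, ‖fderiv ℝ (u t) x‖ ^ 2‖ₑ ≤
      ∫⁻ t in Ioo 0 T, ∫⁻ x, ENNReal.ofReal (frobeniusNormSq (G t x)) := by
    calc ∫⁻ t in I, ‖∫ x in closedBall c r, ‖fderiv ℝ (u t) x‖ ^ 2‖ₑ
        = ∫⁻ t in I, ENNReal.ofReal (∫ x in closedBall c r, ‖fderiv ℝ (u t) x‖ ^ 2) :=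
          lintegral_congr fun t => by
            rw [Real.enorm_eq_ofReal (setIntegral_nonneg measurableSet_closedBall fun x _ => by positivity)]
      _ ≤ ∫⁻ t in I, ∫⁻ x, ENNReal.ofReal (frobeniusNormSq (G t x)) := lintegral_mono_ae hbound
      _ ≤ ∫⁻ t in Ioo 0 T, ∫⁻ x, ENNReal.ofReal (frobeniusNormSq (G t x)) :=
          lintegral_mono_set hIT
  exact lt_of_le_of_lt hle hGfin

/-- **The local kinetic energy of a Leray–Hopf solution is bounded by twice the initial energy**
(energy inequality with `f = 0`). [folklore] -/
private theorem IsLerayHopfOn.setIntegral_norm_sq_le_cw {T ν : ℝ} (hν : 0 ≤ ν)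
    {u₀ : (EuclideanSpace ℝ (Fin 3)) → (EuclideanSpace ℝ (Fin 3))}
    {u : ℝ → (EuclideanSpace ℝ (Fin 3)) → (EuclideanSpace ℝ (Fin 3))}
    (hLH : IsLerayHopfOn T ν 0 u₀ u) {t : ℝ} (ht : t ∈ Icc 0 T) (A : Set (EuclideanSpace ℝ (Fin 3))) :
    ∫ x in A, ‖u t x‖ ^ 2 ≤ 2 * VectorCalculus.kineticEnergy u₀ := by
  obtain ⟨G, -, -, hen, -⟩ := hLH.weakGrad_energy
  have h := hen t ht
  have hf0 : ∫ τ in (0 : ℝ)..t, ∫ x, ⟪(0 : ℝ → (EuclideanSpace ℝ (Fin 3)) → (EuclideanSpace ℝ (Fin 3))) τ x, u τ x⟫ = 0 := by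
    simp
  rw [hf0, add_zero] at h
  have hdiss : 0 ≤ ν * (∫⁻ τ in Ioo 0 t, ∫⁻ x, ENNReal.ofReal (frobeniusNormSq (G τ x))).toReal :=
    mul_nonneg hν ENNReal.toReal_nonneg
  have hint : Integrable (fun x => ‖u t x‖ ^ 2) :=
    (memLp_two_iff_integrable_sq_norm (hLH.memLp t ht).1).1 (hLH.memLp t ht)
  have hKE : VectorCalculus.kineticEnergy (u t) = 2⁻¹ * ∫ x, ‖u t x‖ ^ 2 := rfl
  calc ∫ x in A, ‖u t x‖ ^ 2 ≤ ∫ x, ‖u t x‖ ^ 2 :=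
        setIntegral_le_integral hint (ae_of_all _ fun x => by positivity)
    _ = 2 * VectorCalculus.kineticEnergy (u t) := by rw [hKE]; ring
    _ ≤ 2 * VectorCalculus.kineticEnergy u₀ := by linarith

/-! ### Elementary geometry of unit vectors and of the direction field -/

/-- `‖a × b‖ ≤ ‖a‖‖b‖`. [folklore] -/
private theorem norm_cross_le_mul_cw (a b : EuclideanSpace ℝ (Fin 3)) : ‖cross a b‖ ≤ ‖a‖ * ‖b‖ := by
  rw [norm_cross]
  exact mul_le_of_le_one_right (mul_nonneg (norm_nonneg _) (norm_nonneg _)) (Real.sin_le_one _)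

/-- `‖a × b‖ = ‖b × a‖`. [folklore] -/
private theorem norm_cross_comm_cw (a b : EuclideanSpace ℝ (Fin 3)) : ‖cross a b‖ = ‖cross b a‖ := by
  rw [norm_cross, norm_cross, InnerProductGeometry.angle_comm]
  ring

/-- `a × a = 0`. [folklore] -/
private theorem cross_self_cw (a : EuclideanSpace ℝ (Fin 3)) : cross a a = 0 := by
  have h : ‖cross a a‖ = 0 := by
    rw [norm_cross]
    by_cases ha : a = 0
    · rw [ha, norm_zero]; ring
    · rw [InnerProductGeometry.angle_self ha, Real.sin_zero]; ring
  exact norm_eq_zero.1 h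

/-- `0 × b = 0`. [folklore] -/
private theorem cross_zero_left_cw (b : EuclideanSpace ℝ (Fin 3)) : cross 0 b = 0 :=
  norm_eq_zero.1 (le_antisymm ((norm_cross_le_mul_cw 0 b).trans (by rw [norm_zero, zero_mul]))
    (norm_nonneg _))

/-- `‖ξ(x)‖ ≤ 1` (`= 1` where `ω ≠ 0`, `= 0` at the zeros). [folklore] -/
private theorem norm_vorticityDirection_le_one_cw (w : (EuclideanSpace ℝ (Fin 3)) → (EuclideanSpace ℝ (Fin 3)))
    (x : EuclideanSpace ℝ (Fin 3)) : ‖vorticityDirection w x‖ ≤ 1 := by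
  by_cases hx : w x = 0
  · rw [(vorticityDirection_eq_zero_iff w x).2 hx, norm_zero]; exact zero_le_one
  · rw [norm_vorticityDirection w hx]

/-- For a unit vector `a`, `‖a × b‖ ≤ ‖b − a‖` (`a × b = a × (b − a)`). [folklore] -/
private theorem norm_cross_le_norm_sub_cw {a : EuclideanSpace ℝ (Fin 3)} (b : EuclideanSpace ℝ (Fin 3))
    (ha : ‖a‖ = 1) : ‖cross a b‖ ≤ ‖b - a‖ := by
  have e : cross a b = cross a (b - a) := by
    rw [← crossCLM_apply, ← crossCLM_apply, map_sub, crossCLM_apply a a, cross_self_cw, sub_zero]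
  rw [e]
  calc ‖cross a (b - a)‖ ≤ ‖a‖ * ‖b - a‖ := norm_cross_le_mul_cw _ _
    _ = ‖b - a‖ := by rw [ha, one_mul]

/-- The direction map `a ↦ a/|a|` is `2/|a|`-Lipschitz from a point `a ≠ 0`:
`‖ξ(z) − ξ(y)‖ ≤ 2‖w(z) − w(y)‖/‖w(y)‖`. [folklore] -/
private theorem norm_vorticityDirection_sub_le_cw {w : (EuclideanSpace ℝ (Fin 3)) → (EuclideanSpace ℝ (Fin 3))}
    {y : EuclideanSpace ℝ (Fin 3)} (hy : w y ≠ 0) (z : EuclideanSpace ℝ (Fin 3)) :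
    ‖vorticityDirection w z - vorticityDirection w y‖ ≤ 2 * ‖w z - w y‖ / ‖w y‖ := by
  have hna : 0 < ‖w y‖ := norm_pos_iff.2 hy
  rw [vorticityDirection_apply, vorticityDirection_apply]
  by_cases hz : w z = 0
  · rw [hz, smul_zero, zero_sub, norm_neg, norm_smul, norm_inv, norm_norm, inv_mul_cancel₀ hna.ne',
      zero_sub, norm_neg, le_div_iff₀ hna]
    linarith
  have hnb : 0 < ‖w z‖ := norm_pos_iff.2 hz
  have h1 : ‖‖w z‖⁻¹ • w z - ‖w y‖⁻¹ • w z‖ = ‖w y‖⁻¹ * |‖w y‖ - ‖w z‖| := by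
    rw [← sub_smul, norm_smul, Real.norm_eq_abs]
    have e : (‖w z‖⁻¹ - ‖w y‖⁻¹) * ‖w z‖ = ‖w y‖⁻¹ * (‖w y‖ - ‖w z‖) := by
      rw [sub_mul, inv_mul_cancel₀ hnb.ne', mul_sub, inv_mul_cancel₀ hna.ne']
    calc |‖w z‖⁻¹ - ‖w y‖⁻¹| * ‖w z‖ = |(‖w z‖⁻¹ - ‖w y‖⁻¹) * ‖w z‖| := by
          rw [abs_mul, abs_of_pos hnb]
      _ = ‖w y‖⁻¹ * |‖w y‖ - ‖w z‖| := by rw [e, abs_mul, abs_of_pos (inv_pos.2 hna)]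
  have h2 : ‖‖w y‖⁻¹ • w z - ‖w y‖⁻¹ • w y‖ = ‖w y‖⁻¹ * ‖w z - w y‖ := by
    rw [← smul_sub, norm_smul, norm_inv, norm_norm]
  have h3 : |‖w y‖ - ‖w z‖| ≤ ‖w z - w y‖ := by
    rw [abs_sub_comm]; exact abs_norm_sub_norm_le _ _
  calc ‖‖w z‖⁻¹ • w z - ‖w y‖⁻¹ • w y‖
      ≤ ‖‖w z‖⁻¹ • w z - ‖w y‖⁻¹ • w z‖ + ‖‖w y‖⁻¹ • w z - ‖w y‖⁻¹ • w y‖ :=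
        norm_sub_le_norm_sub_add_norm_sub _ _ _
    _ = ‖w y‖⁻¹ * |‖w y‖ - ‖w z‖| + ‖w y‖⁻¹ * ‖w z - w y‖ := by rw [h1, h2]
    _ ≤ ‖w y‖⁻¹ * ‖w z - w y‖ + ‖w y‖⁻¹ * ‖w z - w y‖ := by
        gcongr
    _ = 2 * ‖w z - w y‖ / ‖w y‖ := by
        field_simp
        ring

/-! ### The `γ`-Hölder measure of coherence on a slice: the defining inequality, boundedness on the
high-vorticity points, lower semicontinuity -/

/-- The defining inequality of the supremum `ρ_{γ,r}`: for `y ∈ B(x, r)`, `y ≠ x`,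
`|ξ(x) × ξ(y)|/|x − y|^γ ≤ ρ_{γ,r}(x)`. [cite: GrujicGuberovic2010, §1 p. 410 (definition of `ρ_{γ,r}`)] -/
private theorem ofReal_div_le_coherenceQuotient_cw {γ r : ℝ}
    {u : ℝ → (EuclideanSpace ℝ (Fin 3)) → (EuclideanSpace ℝ (Fin 3))} {t : ℝ}
    {x y : EuclideanSpace ℝ (Fin 3)} (hy : y ∈ ball x r) (hyx : y ≠ x) :
    ENNReal.ofReal (‖cross (vorticityDirection (curl (u t)) x) (vorticityDirection (curl (u t)) y)‖ /
        ‖x - y‖ ^ γ) ≤ GrujicGuberovic2010.coherenceQuotient γ r u t x := by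
  unfold GrujicGuberovic2010.coherenceQuotient
  exact le_iSup_of_le y (le_iSup_of_le hy (le_iSup_of_le hyx le_rfl))

/-- **The coherence measure is bounded on the high-vorticity points of a slice**: if `ω(t)` is
`L`-Lipschitz on `B(x₀, 3R)`, then for `y ∈ B(x₀, 2R)` with `|ω(y,t)| > Ω > 0` and `0 < γ ≤ 1`,
`ρ_{γ,2R}(y,t) ≤ max (2LR^{1−γ}/Ω, R^{−γ})` — near pairs by
`|ξ(y) × ξ(z)| ≤ |ξ(z) − ξ(y)| ≤ 2|ω(z) − ω(y)|/|ω(y)| ≤ 2L|y − z|/Ω`, far pairs (`|y − z| ≥ R`) by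
`|ξ(y) × ξ(z)| ≤ 1`. [cite: GrujicGuberovic2010, §1 p. 410 (definition of `ρ_{γ,r}`)] -/
private theorem coherenceQuotient_le_of_lipschitz_cw {γ R L Ω : ℝ} (hγ0 : 0 < γ) (hγ1 : γ ≤ 1)
    (hR : 0 < R) (hL : 0 ≤ L) (hΩ : 0 < Ω)
    {u : ℝ → (EuclideanSpace ℝ (Fin 3)) → (EuclideanSpace ℝ (Fin 3))} {t : ℝ}
    {x₀ y : EuclideanSpace ℝ (Fin 3)}
    (hLip : ∀ a ∈ ball x₀ (3 * R), ∀ b ∈ ball x₀ (3 * R),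
      ‖curl (u t) b - curl (u t) a‖ ≤ L * ‖b - a‖)
    (hy : y ∈ ball x₀ (2 * R)) (hΩy : Ω < ‖curl (u t) y‖) :
    GrujicGuberovic2010.coherenceQuotient γ (2 * R) u t y ≤
      ENNReal.ofReal (max (2 * L * R ^ (1 - γ) / Ω) (R ^ (-γ))) := by
  unfold GrujicGuberovic2010.coherenceQuotient
  refine iSup_le fun z => iSup_le fun hz => iSup_le fun hzy => ENNReal.ofReal_le_ofReal ?_
  set ξ := vorticityDirection (curl (u t)) with hξ
  have hy0 : curl (u t) y ≠ 0 := fun h => by rw [h, norm_zero] at hΩy; exact lt_irrefl _ (hΩ.trans hΩy)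
  have hξy : ‖ξ y‖ = 1 := norm_vorticityDirection _ hy0
  have hd0 : 0 < ‖y - z‖ := norm_pos_iff.2 (sub_ne_zero.2 (Ne.symm hzy))
  have hdγ : 0 < ‖y - z‖ ^ γ := Real.rpow_pos_of_pos hd0 γ
  by_cases hd : ‖y - z‖ < R
  · -- near pairs: the direction is Lipschitz from `y`
    have hz3 : z ∈ ball x₀ (3 * R) := by
      rw [mem_ball] at hy ⊢
      calc dist z x₀ ≤ dist z y + dist y x₀ := dist_triangle _ _ _
        _ < R + 2 * R := by
            rw [dist_eq_norm, ← norm_neg, neg_sub]; exact add_lt_add hd hy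
        _ = 3 * R := by ring
    have hy3 : y ∈ ball x₀ (3 * R) := by
      rw [mem_ball] at hy ⊢; linarith
    have h1 : ‖cross (ξ y) (ξ z)‖ ≤ ‖ξ z - ξ y‖ := norm_cross_le_norm_sub_cw _ hξy
    have h2 : ‖ξ z - ξ y‖ ≤ 2 * ‖curl (u t) z - curl (u t) y‖ / ‖curl (u t) y‖ :=
      norm_vorticityDirection_sub_le_cw hy0 z
    have h3 : ‖curl (u t) z - curl (u t) y‖ ≤ L * ‖y - z‖ := by
      have h := hLip y hy3 z hz3
      rwa [norm_sub_rev z y] at h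
    have h4 : ‖cross (ξ y) (ξ z)‖ ≤ 2 * L * ‖y - z‖ / Ω := by
      have h23 : 2 * ‖curl (u t) z - curl (u t) y‖ / ‖curl (u t) y‖ ≤ 2 * (L * ‖y - z‖) / Ω := by
        have hn : 0 ≤ 2 * ‖curl (u t) z - curl (u t) y‖ := by positivity
        calc 2 * ‖curl (u t) z - curl (u t) y‖ / ‖curl (u t) y‖
            ≤ 2 * ‖curl (u t) z - curl (u t) y‖ / Ω :=
              div_le_div_of_nonneg_left hn hΩ hΩy.le
          _ ≤ 2 * (L * ‖y - z‖) / Ω := by gcongr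
      calc ‖cross (ξ y) (ξ z)‖ ≤ 2 * (L * ‖y - z‖) / Ω := h1.trans (h2.trans h23)
        _ = 2 * L * ‖y - z‖ / Ω := by ring
    have h5 : ‖y - z‖ / ‖y - z‖ ^ γ = ‖y - z‖ ^ (1 - γ) := by
      rw [Real.rpow_sub hd0, Real.rpow_one]
    have h6 : ‖y - z‖ ^ (1 - γ) ≤ R ^ (1 - γ) :=
      Real.rpow_le_rpow hd0.le hd.le (by linarith)
    calc ‖cross (ξ y) (ξ z)‖ / ‖y - z‖ ^ γ ≤ (2 * L * ‖y - z‖ / Ω) / ‖y - z‖ ^ γ :=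
          div_le_div_of_nonneg_right h4 hdγ.le
      _ = 2 * L / Ω * (‖y - z‖ / ‖y - z‖ ^ γ) := by ring
      _ = 2 * L / Ω * ‖y - z‖ ^ (1 - γ) := by rw [h5]
      _ ≤ 2 * L / Ω * R ^ (1 - γ) := by gcongr
      _ = 2 * L * R ^ (1 - γ) / Ω := by ring
      _ ≤ max (2 * L * R ^ (1 - γ) / Ω) (R ^ (-γ)) := le_max_left _ _
  · -- far pairs
    rw [not_lt] at hd
    have h1 : ‖cross (ξ y) (ξ z)‖ ≤ 1 := by
      calc ‖cross (ξ y) (ξ z)‖ ≤ ‖ξ y‖ * ‖ξ z‖ := norm_cross_le_mul_cw _ _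
        _ ≤ 1 * 1 := mul_le_mul hξy.le (norm_vorticityDirection_le_one_cw _ _) (norm_nonneg _) zero_le_one
        _ = 1 := one_mul _
    have hRγ : 0 < R ^ γ := Real.rpow_pos_of_pos hR γ
    calc ‖cross (ξ y) (ξ z)‖ / ‖y - z‖ ^ γ ≤ 1 / ‖y - z‖ ^ γ :=
          div_le_div_of_nonneg_right h1 hdγ.le
      _ ≤ 1 / R ^ γ := one_div_le_one_div_of_le hRγ (Real.rpow_le_rpow hR.le hd hγ0.le)
      _ = R ^ (-γ) := by rw [Real.rpow_neg hR.le, one_div]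
      _ ≤ max (2 * L * R ^ (1 - γ) / Ω) (R ^ (-γ)) := le_max_right _ _

/-- **The coherence measure of a slice with continuous vorticity is lower semicontinuous**, after
restriction to an open set `U` inside the region of continuity (extended by `0`): each quotient
`x ↦ |ξ(x) × ξ(y)|/|x − y|^γ · 1[y ∈ B(x, r), y ≠ x]` is lower semicontinuous (continuous where
`ω(x) ≠ 0`, and `= 0`, the least value, where `ω(x) = 0`), and a supremum of lower semicontinuous
functions is lower semicontinuous. Hence the slice is Borel measurable. [folklore] -/
private theorem measurable_indicator_coherenceQuotient_cw {γ r : ℝ} (hγ : 0 < γ)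
    {u : ℝ → (EuclideanSpace ℝ (Fin 3)) → (EuclideanSpace ℝ (Fin 3))} {t : ℝ}
    {U V : Set (EuclideanSpace ℝ (Fin 3))} (hU : IsOpen U) (hV : IsOpen V) (hUV : U ⊆ V)
    (hω : ContinuousOn (curl (u t)) V) :
    Measurable (U.indicator (GrujicGuberovic2010.coherenceQuotient γ r u t)) := by
  set w := curl (u t) with hw
  set ξ := vorticityDirection w with hξ
  -- the quotient for a fixed second point `y`
  set g : (EuclideanSpace ℝ (Fin 3)) → (EuclideanSpace ℝ (Fin 3)) → ℝ≥0∞ := fun y x =>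
    ⨆ (_ : y ∈ ball x r), ⨆ (_ : y ≠ x), ENNReal.ofReal (‖cross (ξ x) (ξ y)‖ / ‖x - y‖ ^ γ) with hg
  have hρ : ∀ x, GrujicGuberovic2010.coherenceQuotient γ r u t x = ⨆ y, g y x := fun x => rfl
  -- each quotient is lower semicontinuous at the points of `V`
  have hgl : ∀ y, ∀ x₁ ∈ V, LowerSemicontinuousAt (g y) x₁ := by
    intro y x₁ hx₁ z hz
    by_cases hP : y ∈ ball x₁ r ∧ y ≠ x₁
    · have hval : g y x₁ = ENNReal.ofReal (‖cross (ξ x₁) (ξ y)‖ / ‖x₁ - y‖ ^ γ) := by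
        simp only [hg, iSup_pos hP.1, iSup_pos hP.2]
      rw [hval] at hz
      by_cases h0 : w x₁ = 0
      · have hξ0 : ξ x₁ = 0 := (vorticityDirection_eq_zero_iff w x₁).2 h0
        rw [hξ0, cross_zero_left_cw, norm_zero, zero_div, ENNReal.ofReal_zero] at hz
        exact absurd hz ENNReal.not_lt_zero
      -- continuity of the quotient at `x₁`
      have hwc : ContinuousAt w x₁ := hω.continuousAt (hV.mem_nhds hx₁)
      have hξc : ContinuousAt ξ x₁ := by
        show ContinuousAt (fun x => ‖w x‖⁻¹ • w x) x₁
        exact (hwc.norm.inv₀ (norm_ne_zero_iff.2 h0)).smul hwc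
      have hcr : Continuous fun a : EuclideanSpace ℝ (Fin 3) => cross a (ξ y) := by
        have h := (crossCLM.flip (ξ y)).continuous
        refine h.congr fun a => ?_
        rw [ContinuousLinearMap.flip_apply, crossCLM_apply]
      have hnum : ContinuousAt (fun x => ‖cross (ξ x) (ξ y)‖) x₁ :=
        (hcr.continuousAt.comp hξc).norm
      have hden : ContinuousAt (fun x : EuclideanSpace ℝ (Fin 3) => ‖x - y‖ ^ γ) x₁ :=
        ((continuous_id.sub continuous_const).norm.rpow_const fun _ => Or.inr hγ.le).continuousAt
      have hden0 : ‖x₁ - y‖ ^ γ ≠ 0 :=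
        (Real.rpow_pos_of_pos (norm_pos_iff.2 (sub_ne_zero.2 (Ne.symm hP.2))) γ).ne'
      have hq : ContinuousAt (fun x => ENNReal.ofReal (‖cross (ξ x) (ξ y)‖ / ‖x - y‖ ^ γ)) x₁ :=
        ENNReal.continuous_ofReal.continuousAt.comp (hnum.div hden hden0)
      have hO1 : IsOpen {x : EuclideanSpace ℝ (Fin 3) | y ∈ ball x r} := by
        simp only [mem_ball]
        exact isOpen_lt (continuous_const.dist continuous_id) continuous_const
      have hO2 : IsOpen {x : EuclideanSpace ℝ (Fin 3) | y ≠ x} := isOpen_ne_fun continuous_const continuous_id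
      filter_upwards [hO1.mem_nhds hP.1, hO2.mem_nhds hP.2, hq.preimage_mem_nhds (Ioi_mem_nhds hz)]
        with x hx1 hx2 hx3
      simp only [hg, iSup_pos hx1, iSup_pos hx2]
      exact hx3
    · have hval : g y x₁ = 0 := by
        simp only [hg]
        by_cases h1 : y ∈ ball x₁ r
        · have h2 : ¬ (y ≠ x₁) := fun h => hP ⟨h1, h⟩
          rw [iSup_pos h1, iSup_neg h2, ENNReal.bot_eq_zero]
        · rw [iSup_neg h1, ENNReal.bot_eq_zero]
      rw [hval] at hz
      exact absurd hz ENNReal.not_lt_zero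
  -- lower semicontinuity of the restricted supremum
  have hlsc : LowerSemicontinuous (U.indicator (GrujicGuberovic2010.coherenceQuotient γ r u t)) := by
    intro x₁ z hz
    by_cases hx₁ : x₁ ∈ U
    · rw [indicator_of_mem hx₁, hρ] at hz
      have hsup : LowerSemicontinuousAt (fun x => ⨆ y, g y x) x₁ :=
        lowerSemicontinuousAt_iSup fun y => hgl y x₁ (hUV hx₁)
      filter_upwards [hsup z hz, hU.mem_nhds hx₁] with x hx hxU
      rw [indicator_of_mem hxU, hρ]
      exact hx
    · rw [indicator_of_notMem hx₁] at hz
      exact absurd hz ENNReal.not_lt_zero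
  exact hlsc.measurable

/-- **A Lipschitz constant for a smooth slice on a ball**: if `u` is jointly `C^∞` on `I × S` and
`B̄(x₀, ρ') ⊆ S`, then `ω(t) = curl u(t)` is Lipschitz on `B(x₀, ρ')` for `t ∈ I` (mean value
inequality with `sup_{B̄} ‖∇ω(t)‖`). [folklore] -/
private theorem exists_lipschitz_curl_slice_cw
    {u : ℝ → (EuclideanSpace ℝ (Fin 3)) → (EuclideanSpace ℝ (Fin 3))} {I : Set ℝ}
    {S : Set (EuclideanSpace ℝ (Fin 3))} (hS : IsOpen S)
    (hu : ContDiffOn ℝ ∞ (uncurry u) (I ×ˢ S)) {x₀ : EuclideanSpace ℝ (Fin 3)} {ρ' : ℝ}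
    (hK : closedBall x₀ ρ' ⊆ S) {t : ℝ} (ht : t ∈ I) :
    ∃ L : ℝ, 0 ≤ L ∧ ∀ a ∈ ball x₀ ρ', ∀ b ∈ ball x₀ ρ',
      ‖curl (u t) b - curl (u t) a‖ ≤ L * ‖b - a‖ := by
  have hut : ContDiffOn ℝ ∞ (u t) S := by
    have h : ContDiffOn ℝ ∞ (fun x : (EuclideanSpace ℝ (Fin 3)) => ((t, x) : ℝ × (EuclideanSpace ℝ (Fin 3)))) S :=
      contDiffOn_const.prodMk contDiffOn_id
    exact hu.comp h fun x hx => ⟨ht, hx⟩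
  obtain ⟨V, hV, N, hNo, hKN, -, hVu⟩ :=
    ContDiffOn.exists_contDiff_eqOn_nhds_of_isCompact hut hS (isCompact_closedBall x₀ ρ') hK
  have hV2 : ContDiff ℝ 2 V := contDiff_infty.1 hV 2
  have hω1 : ContDiff ℝ 1 (curl V) := contDiff_curl (n := 1) (by exact hV2)
  have hDω : Continuous (fderiv ℝ (curl V)) := hω1.continuous_fderiv one_ne_zero
  obtain ⟨L₀, hL₀⟩ := (isCompact_closedBall x₀ ρ').exists_bound_of_continuousOn hDω.continuousOn
  set L : ℝ := max L₀ 0 with hLdef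
  have hcurl : ∀ x ∈ N, curl V x = curl (u t) x := fun x hx => by
    have hDVeq : fderiv ℝ V x = fderiv ℝ (u t) x :=
      (eventuallyEq_of_mem (hNo.mem_nhds hx) hVu).fderiv_eq
    rw [curl_eq_curlCLM, curl_eq_curlCLM, hDVeq]
  refine ⟨L, le_max_right _ _, fun a ha b hb => ?_⟩
  have hmv := (convex_ball x₀ ρ').norm_image_sub_le_of_norm_fderiv_le (f := curl V) (C := L)
    (fun x _ => (hω1.differentiable one_ne_zero) x)
    (fun x hx => (hL₀ x (ball_subset_closedBall hx)).trans (le_max_left L₀ 0)) ha hb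
  rwa [hcurl a (hKN (ball_subset_closedBall ha)), hcurl b (hKN (ball_subset_closedBall hb))] at hmv

/-! ### The discharge -/

set_option maxHeartbeats 1600000 in
/-- **Grujić–Guberović 2010, Theorem 2 — proved.** A Leray–Hopf solution smooth on
`(t₀ − (2R)², t₀) × B(x₀, 4R)` with `∫_{t₀−(2R)²}^{t₀} (∫_{B(x₀,2R)} |ω|^α ρ_{γ,2R}^α)^{2/((2+γ)α−3)} < ∞`
(`0 < γ < 1`, `3/(γ+2) < α < 3/γ`, `ρ_{γ,2R}` the `γ`-Hölder measure of coherence of the vorticity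
direction) has bounded localized enstrophy up to `t₀`: the named fact
`grujicGuberovic2010_coherenceWeighted_criterion` holds. Assembled from
`IsLerayHopfOn.exists_weight_localEnstrophy_deriv_le_holderWeight` (weight `m(t,y) = ρ_{γ,2R}(y,t)`
on the high-vorticity points of `B(x₀, 2R)`), the measurability and boundedness of that weight, the
Leray–Hopf energy structure, the domination of the Grönwall weight by the hypothesis, Grönwall's
inequality in lower-integral form and a finite cover of `B̄(x₀, R)`; see the module docstring.
[cite: GrujicGuberovic2010, Thm. 2 (p. 415) with its proof pp. 415–417] -/
theorem grujicGuberovic2010_coherenceWeighted_criterion_holds :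
    grujicGuberovic2010_coherenceWeighted_criterion := by
  intro T _hT u₀ u hLH x₀ t₀ R γ α hR _hR1 ht₀ ht₀T hγ0 hγ1 hαlo hαhi hsm hi
  -- ### exponents (Hölder exponent `γ`, Lebesgue exponent `α` in the notation of the bricks)
  have hγ2 : 0 < γ + 2 := by linarith
  have h3α : 3 < α * (γ + 2) := by
    have h := hαlo; rw [div_lt_iff₀ hγ2] at h; exact h
  have hα1 : 1 < α := by nlinarith
  have hα0 : 0 < α := by linarith
  have hγα : γ * α < 3 := by
    have h := hαhi; rw [lt_div_iff₀ hγ0] at h; linarith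
  have hup : 1 / α < (2 + γ) / 3 := by
    rw [div_lt_div_iff₀ hα0 (by norm_num : (0 : ℝ) < 3)]; linarith
  set θ : ℝ := 1 + γ / 2 - 3 / 2 * (1 / α) with hθdef
  have hden : 0 < (2 + γ) * α - 3 := by linarith
  have hαθ : α * θ = ((2 + γ) * α - 3) / 2 := by
    rw [hθdef]; field_simp
  have he : 1 / (α * θ) = 2 / ((2 + γ) * α - 3) := by
    rw [hαθ, one_div_div]
  have he0 : 0 ≤ 2 / ((2 + γ) * α - 3) := by positivity
  have he0' : 0 ≤ 1 / (α * θ) := by rw [he]; exact he0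
  -- ### the cylinder of smoothness
  set I : Set ℝ := Ioo (t₀ - (2 * R) ^ 2) t₀ with hIdef
  set S : Set (EuclideanSpace ℝ (Fin 3)) := ball x₀ (4 * R) with hSdef
  have hI : IsOpen I := isOpen_Ioo
  have hS : IsOpen S := isOpen_ball
  have hIT : I ⊆ Ioo 0 T := fun t ht => ⟨by have := ht.1; nlinarith, ht.2.trans ht₀T⟩
  have hu : ContDiffOn ℝ ∞ (uncurry u) (I ×ˢ S) := hsm
  obtain ⟨-, -, hDU, hω0, -, -, -⟩ := hLH.vorticity_classical_of_contDiffOn hI hS hIT hu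
  have hpmk : ∀ t : ℝ, Continuous (fun x : (EuclideanSpace ℝ (Fin 3)) => ((t, x) : ℝ × (EuclideanSpace ℝ (Fin 3)))) :=
    fun t => continuous_const.prodMk continuous_id
  have hslDU : ∀ t ∈ I, ContinuousOn (fun x => fderiv ℝ (u t) x) S := fun t ht =>
    hDU.comp (hpmk t).continuousOn fun x hx => ⟨ht, hx⟩
  have hslω : ∀ t ∈ I, ContinuousOn (fun x => curl (u t) x) S := fun t ht =>
    hω0.comp (hpmk t).continuousOn fun x hx => ⟨ht, hx⟩
  have h2RS : ball x₀ (2 * R) ⊆ S := ball_subset_ball (by linarith)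
  have h3RS : closedBall x₀ (3 * R) ⊆ S := closedBall_subset_ball (by linarith)
  -- ### the coherence weight on the slices: measurable, nonnegative, bounded
  set ρU : ℝ → (EuclideanSpace ℝ (Fin 3)) → ℝ≥0∞ := fun t =>
    (ball x₀ (2 * R)).indicator (GrujicGuberovic2010.coherenceQuotient γ (2 * R) u t) with hρU
  have hρUm : ∀ t ∈ I, Measurable (ρU t) := fun t ht =>
    measurable_indicator_coherenceQuotient_cw hγ0 isOpen_ball hS h2RS (hslω t ht)
  have hLip : ∀ t ∈ I, ∃ L : ℝ, 0 ≤ L ∧ ∀ a ∈ ball x₀ (3 * R), ∀ b ∈ ball x₀ (3 * R),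
      ‖curl (u t) b - curl (u t) a‖ ≤ L * ‖b - a‖ := fun t ht =>
    exists_lipschitz_curl_slice_cw hS hu h3RS ht
  set m : ℝ → (EuclideanSpace ℝ (Fin 3)) → ℝ := fun t y =>
    ({y : EuclideanSpace ℝ (Fin 3) | y ∈ ball x₀ (2 * R) ∧ (1 : ℝ) < ‖curl (u t) y‖}).indicator
      (fun y => (ρU t y).toReal) y with hmdef
  have hm0' : ∀ t y, 0 ≤ m t y := fun t y => by
    simp only [hmdef]
    exact indicator_nonneg (fun _ _ => ENNReal.toReal_nonneg) _
  have hm0 : ∀ t ∈ I, ∀ y, 0 ≤ m t y := fun t _ y => hm0' t y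
  have hmm : ∀ t ∈ I, Measurable (m t) := by
    intro t ht
    have hO : IsOpen {y : EuclideanSpace ℝ (Fin 3) | y ∈ ball x₀ (2 * R) ∧ (1 : ℝ) < ‖curl (u t) y‖} := by
      have h' : IsOpen (S ∩ (fun x => ‖curl (u t) x‖) ⁻¹' Ioi 1) :=
        (hslω t ht).norm.isOpen_inter_preimage hS isOpen_Ioi
      have e : {y : EuclideanSpace ℝ (Fin 3) | y ∈ ball x₀ (2 * R) ∧ (1 : ℝ) < ‖curl (u t) y‖} =
          ball x₀ (2 * R) ∩ (S ∩ (fun x => ‖curl (u t) x‖) ⁻¹' Ioi 1) := by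
        ext y
        simp only [mem_setOf_eq, mem_inter_iff, mem_preimage, mem_Ioi]
        exact ⟨fun h => ⟨h.1, h2RS h.1, h.2⟩, fun h => ⟨h.1, h.2.2⟩⟩
      rw [e]; exact isOpen_ball.inter h'
    exact (hρUm t ht).ennreal_toReal.indicator hO.measurableSet
  have hρle : ∀ t ∈ I, ∃ B : ℝ, 0 ≤ B ∧ ∀ y ∈ ball x₀ (2 * R), (1 : ℝ) < ‖curl (u t) y‖ →
      GrujicGuberovic2010.coherenceQuotient γ (2 * R) u t y ≤ ENNReal.ofReal B := by
    intro t ht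
    obtain ⟨L, hL0, hL⟩ := hLip t ht
    refine ⟨max (2 * L * R ^ (1 - γ) / 1) (R ^ (-γ)), le_max_of_le_right (Real.rpow_nonneg hR.le _),
      fun y hy h1y => ?_⟩
    exact coherenceQuotient_le_of_lipschitz_cw hγ0 hγ1.le hR hL0 one_pos hL hy h1y
  have hmb : ∀ t ∈ I, ∃ Mb : ℝ, ∀ y, m t y ≤ Mb := by
    intro t ht
    obtain ⟨B, hB0, hB⟩ := hρle t ht
    refine ⟨B, fun y => ?_⟩
    simp only [hmdef]
    by_cases hy : y ∈ {y : EuclideanSpace ℝ (Fin 3) | y ∈ ball x₀ (2 * R) ∧ (1 : ℝ) < ‖curl (u t) y‖}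
    · rw [indicator_of_mem hy]
      have e : ρU t y = GrujicGuberovic2010.coherenceQuotient γ (2 * R) u t y := by
        simp only [hρU, indicator_of_mem hy.1]
      rw [e]
      exact ENNReal.toReal_le_of_le_ofReal hB0 (hB y hy.1 hy.2)
    · rw [indicator_of_notMem hy]; exact hB0
  -- the weight realises the coherence hypothesis of the bricks on every small ball inside `B(x₀, 2R)`
  set s : ℝ := R / 16 with hsdef
  have hs : 0 < s := by positivity
  have hdirI : ∀ c : EuclideanSpace ℝ (Fin 3), ball c (6 * s) ⊆ ball x₀ (2 * R) →
      ∀ t ∈ I, ∀ x ∈ ball c (6 * s), ∀ y ∈ ball c (6 * s),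
        (1 : ℝ) < ‖curl (u t) x‖ → (1 : ℝ) < ‖curl (u t) y‖ →
          Real.sqrt (1 - ⟪vorticityDirection (curl (u t)) x, vorticityDirection (curl (u t)) y⟫ ^ 2) ≤
            m t y * ‖x - y‖ ^ γ := by
    intro c hc6 t ht x hx y hy h1x h1y
    have hx0 : curl (u t) x ≠ 0 := fun h => by rw [h, norm_zero] at h1x; linarith
    have hy0 : curl (u t) y ≠ 0 := fun h => by rw [h, norm_zero] at h1y; linarith
    have hyU : y ∈ ball x₀ (2 * R) := hc6 hy
    have hmem : y ∈ {y : EuclideanSpace ℝ (Fin 3) | y ∈ ball x₀ (2 * R) ∧ (1 : ℝ) < ‖curl (u t) y‖} :=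
      ⟨hyU, h1y⟩
    have hmy : m t y = (GrujicGuberovic2010.coherenceQuotient γ (2 * R) u t y).toReal := by
      simp only [hmdef, indicator_of_mem hmem, hρU, indicator_of_mem hyU]
    obtain ⟨B, hB0, hB⟩ := hρle t ht
    have hρfin : GrujicGuberovic2010.coherenceQuotient γ (2 * R) u t y ≠ ⊤ :=
      ne_top_of_le_ne_top ENNReal.ofReal_ne_top (hB y hyU h1y)
    by_cases hxy : x = y
    · subst hxy
      have e1 : ⟪vorticityDirection (curl (u t)) x, vorticityDirection (curl (u t)) x⟫ = 1 := by
        rw [real_inner_self_eq_norm_sq, norm_vorticityDirection _ hx0, one_pow]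
      simp only [e1, one_pow, sub_self, Real.sqrt_zero, norm_zero, Real.zero_rpow hγ0.ne', mul_zero,
        le_refl]
    have hxball : x ∈ ball y (2 * R) := by
      rw [mem_ball] at hx hy ⊢
      calc dist x y ≤ dist x c + dist y c := dist_triangle_right _ _ _
        _ < 6 * s + 6 * s := add_lt_add hx hy
        _ < 2 * R := by rw [hsdef]; linarith
    have hq := ofReal_div_le_coherenceQuotient_cw (u := u) (t := t) (γ := γ) hxball hxy
    have hreal : ‖cross (vorticityDirection (curl (u t)) y) (vorticityDirection (curl (u t)) x)‖ /
        ‖y - x‖ ^ γ ≤ m t y := by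
      rw [hmy]; exact (ENNReal.ofReal_le_iff_le_toReal hρfin).1 hq
    have hpos : 0 < ‖y - x‖ ^ γ :=
      Real.rpow_pos_of_pos (norm_pos_iff.2 (sub_ne_zero.2 (Ne.symm hxy))) γ
    calc Real.sqrt (1 - ⟪vorticityDirection (curl (u t)) x, vorticityDirection (curl (u t)) y⟫ ^ 2)
        = ‖cross (vorticityDirection (curl (u t)) y) (vorticityDirection (curl (u t)) x)‖ := by
          rw [← real_inner_comm, norm_cross_eq_sqrt_one_sub_inner_sq
            (norm_vorticityDirection _ hy0) (norm_vorticityDirection _ hx0)]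
      _ = ‖cross (vorticityDirection (curl (u t)) y) (vorticityDirection (curl (u t)) x)‖ /
            ‖y - x‖ ^ γ * ‖y - x‖ ^ γ := by rw [div_mul_cancel₀ _ hpos.ne']
      _ ≤ m t y * ‖y - x‖ ^ γ := mul_le_mul_of_nonneg_right hreal hpos.le
      _ = m t y * ‖x - y‖ ^ γ := by rw [norm_sub_rev]
  -- ### the time `a` and the energy bound
  set a : ℝ := t₀ - 2 * R ^ 2 with hadef
  have haI : Ico a t₀ ⊆ I := fun t ht => ⟨by have := ht.1; nlinarith, ht.2⟩
  have ha : a ∈ I := haI ⟨le_rfl, by nlinarith⟩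
  have hIfin : volume (Ico a t₀) < ⊤ := measure_Ico_lt_top
  have hIco_meas : MeasurableSet (Ico a t₀) := measurableSet_Ico
  set E₀ : ℝ := 2 * VectorCalculus.kineticEnergy u₀ with hE₀
  have hEbound : ∀ t ∈ I, ∀ A : Set (EuclideanSpace ℝ (Fin 3)), ∫ x in A, ‖u t x‖ ^ 2 ≤ E₀ := fun t ht A =>
    hLH.setIntegral_norm_sq_le_cw zero_le_one ⟨(hIT ht).1.le, (hIT ht).2.le⟩ A
  -- the hypothesis, as a function of time
  set H : ℝ → ℝ≥0∞ := fun t =>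
    (∫⁻ x in ball x₀ (2 * R), ‖curl (u t) x‖ₑ ^ α *
        GrujicGuberovic2010.coherenceQuotient γ (2 * R) u t x ^ α) ^ (2 / ((2 + γ) * α - 3)) with hHdef
  have hHint : ∫⁻ t in Ico a t₀, H t < ⊤ := lt_of_le_of_lt (lintegral_mono_set haI) hi
  -- ### the bound on one small ball
  have key : ∀ c ∈ closedBall x₀ R, ∃ Cc : ℝ, ∀ t ∈ Ioo (t₀ - R ^ 2) t₀,
      ∫ x in ball c (s / 2), ‖curl (u t) x‖ ^ 2 ≤ Cc := by
    intro c hc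
    rw [mem_closedBall] at hc
    have hcS : closedBall c (12 * s) ⊆ S := fun x hx => by
      rw [mem_closedBall] at hx
      rw [hSdef, mem_ball]
      calc dist x x₀ ≤ dist x c + dist c x₀ := dist_triangle _ _ _
        _ < 4 * R := by rw [hsdef] at hx; linarith
    have hc6 : ball c (6 * s) ⊆ ball x₀ (2 * R) := fun x hx => by
      rw [mem_ball] at hx ⊢
      calc dist x x₀ ≤ dist x c + dist c x₀ := dist_triangle _ _ _
        _ < 2 * R := by rw [hsdef] at hx; linarith
    have h6cU : closedBall c (6 * s) ⊆ ball x₀ (2 * R) := fun x hx => by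
      rw [mem_closedBall] at hx; rw [mem_ball]
      calc dist x x₀ ≤ dist x c + dist c x₀ := dist_triangle _ _ _
        _ < 2 * R := by rw [hsdef] at hx; linarith
    have h6cS : closedBall c (6 * s) ⊆ S := h6cU.trans h2RS
    obtain ⟨φ, D, A₀, A₁, A₂, B₀, B₁, hφ1, hφ01, hA₀, hA₁, hA₂, hB₀, hB₁, hφc, hφs, hYc, hFc, hEc,
      hDc, hder, hle⟩ :=
      hLH.exists_weight_localEnstrophy_deriv_le_holderWeight one_pos hI hS hIT hu c hs hcS hγ0 hα1 hγα
        hup hθdef one_pos hmm hm0 hmb (hdirI c hc6)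
    -- names for the local sizes
    set Y : ℝ → ℝ := fun t => ∫ x in closedBall c (6 * s), ‖curl (u t) x‖ ^ 2 with hYdef
    set F : ℝ → ℝ := fun t => ∫ x in closedBall c (6 * s), ‖fderiv ℝ (u t) x‖ ^ 2 with hFdef
    set E : ℝ → ℝ := fun t => ∫ x in closedBall c (6 * s), ‖u t x‖ ^ 2 with hEdef
    set NW : ℝ → ℝ := fun t =>
      (∫ x in closedBall c (6 * s), (m t x * ‖curl (u t) x‖) ^ α) ^ (1 / (α * θ)) with hNWdef
    set y : ℝ → ℝ := fun t => ∫ x, φ x ^ 2 * ‖curl (u t) x‖ ^ 2 with hydef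
    have hY0 : ∀ t, 0 ≤ Y t := fun t => setIntegral_nonneg measurableSet_closedBall fun x _ => by positivity
    have hF0 : ∀ t, 0 ≤ F t := fun t => setIntegral_nonneg measurableSet_closedBall fun x _ => by positivity
    have hE0 : ∀ t, 0 ≤ E t := fun t => setIntegral_nonneg measurableSet_closedBall fun x _ => by positivity
    have hNWI0 : ∀ t, 0 ≤ ∫ x in closedBall c (6 * s), (m t x * ‖curl (u t) x‖) ^ α := fun t =>
      setIntegral_nonneg measurableSet_closedBall fun x _ =>
        Real.rpow_nonneg (mul_nonneg (hm0' t x) (norm_nonneg _)) _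
    have hNW0 : ∀ t, 0 ≤ NW t := fun t => Real.rpow_nonneg (hNWI0 t) _
    have hy0 : ∀ t, 0 ≤ y t := fun t => integral_nonneg fun x => by positivity
    have hEle : ∀ t ∈ I, E t ≤ E₀ := fun t ht => hEbound t ht _
    -- `Y ≤ ‖curlCLM‖² F`
    have hYF : ∀ t ∈ I, Y t ≤ ‖curlCLM‖ ^ 2 * F t := by
      intro t ht
      have hcont : ContinuousOn (fun x => ‖fderiv ℝ (u t) x‖ ^ 2) (closedBall c (6 * s)) :=
        fun x hx => ((hslDU t ht x (h6cS hx)).norm.pow 2).mono h6cS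
      have hint : IntegrableOn (fun x => ‖fderiv ℝ (u t) x‖ ^ 2) (closedBall c (6 * s)) :=
        hcont.integrableOn_compact (isCompact_closedBall _ _)
      calc Y t ≤ ∫ x in closedBall c (6 * s), ‖curlCLM‖ ^ 2 * ‖fderiv ℝ (u t) x‖ ^ 2 := by
            refine setIntegral_mono_on ?_ (hint.const_mul _) measurableSet_closedBall fun x _ => ?_
            · have hc2 : ContinuousOn (fun x => ‖curl (u t) x‖ ^ 2) (closedBall c (6 * s)) :=
                fun x hx => ((hslω t ht x (h6cS hx)).norm.pow 2).mono h6cS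
              exact hc2.integrableOn_compact (isCompact_closedBall _ _)
            · rw [curl_eq_curlCLM, ← mul_pow]
              exact pow_le_pow_left₀ (norm_nonneg _) (ContinuousLinearMap.le_opNorm _ _) 2
        _ = ‖curlCLM‖ ^ 2 * F t := integral_const_mul _ _
    -- integrability of the continuous coefficients on `[a, t₀)`
    have hFi : IntegrableOn F (Ico a t₀) :=
      (hLH.integrableOn_localGradSq_cw hI hS hIT hu h6cS hFc).mono_set haI
    have hYi : IntegrableOn Y (Ico a t₀) := by
      refine Integrable.mono' (hFi.const_mul (‖curlCLM‖ ^ 2))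
        ((hYc.mono haI).aestronglyMeasurable hIco_meas) ?_
      refine ae_restrict_of_forall_mem hIco_meas fun t ht => ?_
      rw [Real.norm_of_nonneg (hY0 t)]
      exact hYF t (haI ht)
    have hEi : IntegrableOn E (Ico a t₀) := by
      refine Integrable.mono' (integrableOn_const (C := E₀) (hs := hIfin.ne))
        ((hEc.mono haI).aestronglyMeasurable hIco_meas) ?_
      refine ae_restrict_of_forall_mem hIco_meas fun t ht => ?_
      rw [Real.norm_of_nonneg (hE0 t)]
      exact hEle t (haI ht)
    set αc : ℝ → ℝ := fun t => A₀ + A₁ * (Y t + F t + E t) with hαcdef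
    set β : ℝ → ℝ := fun t => (B₀ + B₁ * E t ^ 2) * (Y t + F t) with hβdef
    have hαcc : ContinuousOn αc I := continuousOn_const.add (continuousOn_const.mul ((hYc.add hFc).add hEc))
    have hβc : ContinuousOn β I := (continuousOn_const.add (continuousOn_const.mul (hEc.pow 2))).mul (hYc.add hFc)
    have hαc0 : ∀ t, 0 ≤ αc t := fun t => by
      have := hY0 t; have := hF0 t; have := hE0 t; positivity
    have hβ0 : ∀ t, 0 ≤ β t := fun t => by
      have := hY0 t; have := hF0 t; have := hE0 t; positivity
    have hαci : IntegrableOn αc (Ico a t₀) :=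
      (integrableOn_const (C := A₀) (hs := hIfin.ne)).add (((hYi.add hFi).add hEi).const_mul A₁)
    have hβi : IntegrableOn β (Ico a t₀) := by
      refine Integrable.mono' (((hYi.add hFi)).const_mul (B₀ + B₁ * E₀ ^ 2))
        ((hβc.mono haI).aestronglyMeasurable hIco_meas) ?_
      refine ae_restrict_of_forall_mem hIco_meas fun t ht => ?_
      rw [Real.norm_of_nonneg (hβ0 t)]
      have h1 : E t ^ 2 ≤ E₀ ^ 2 := pow_le_pow_left₀ (hE0 t) (hEle t (haI ht)) 2
      have h2 : 0 ≤ Y t + F t := add_nonneg (hY0 t) (hF0 t)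
      show (B₀ + B₁ * E t ^ 2) * (Y t + F t) ≤ (B₀ + B₁ * E₀ ^ 2) * (Y t + F t)
      exact mul_le_mul_of_nonneg_right (by nlinarith) h2
    -- the full coefficient `αc + A₂ NW` and the differential inequality
    set acoef : ℝ → ℝ := fun t => αc t + A₂ * NW t with hacoefdef
    have hacoef0 : ∀ t, 0 ≤ acoef t := fun t => add_nonneg (hαc0 t) (mul_nonneg hA₂ (hNW0 t))
    have hle' : ∀ t ∈ I, D t ≤ acoef t * y t + β t := fun t ht => hle t ht
    -- ### the Grönwall weight is dominated by the hypothesis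
    have hNWH : ∀ t ∈ I, ENNReal.ofReal (NW t) ≤ H t := by
      intro t ht
      obtain ⟨Mb, hMb⟩ := hmb t ht
      have hMb0 : 0 ≤ Mb := (hm0' t x₀).trans (hMb x₀)
      have hωc : ContinuousOn (fun x => curl (u t) x) (closedBall c (6 * s)) := (hslω t ht).mono h6cS
      obtain ⟨Bω, hBω⟩ := (isCompact_closedBall c (6 * s)).exists_bound_of_continuousOn hωc
      have hBω0 : 0 ≤ Bω := (norm_nonneg _).trans (hBω c (mem_closedBall_self (by positivity)))
      have hmeas : AEStronglyMeasurable (fun x => (m t x * ‖curl (u t) x‖) ^ α)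
          (volume.restrict (closedBall c (6 * s))) := by
        have h1 : AEMeasurable (m t) (volume.restrict (closedBall c (6 * s))) :=
          (hmm t ht).aemeasurable
        have h2 : AEMeasurable (fun x => ‖curl (u t) x‖) (volume.restrict (closedBall c (6 * s))) :=
          (hωc.norm.aestronglyMeasurable measurableSet_closedBall).aemeasurable
        exact ((h1.mul h2).pow_const α).aestronglyMeasurable
      have hint : IntegrableOn (fun x => (m t x * ‖curl (u t) x‖) ^ α) (closedBall c (6 * s)) := by
        refine IntegrableOn.of_bound measure_closedBall_lt_top hmeas ((Mb * Bω) ^ α) ?_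
        refine (ae_restrict_mem measurableSet_closedBall).mono fun x hx => ?_
        rw [Real.norm_of_nonneg (Real.rpow_nonneg (mul_nonneg (hm0' t x) (norm_nonneg _)) _)]
        exact Real.rpow_le_rpow (mul_nonneg (hm0' t x) (norm_nonneg _))
          (mul_le_mul (hMb x) (hBω x hx) (norm_nonneg _) hMb0) hα0.le
      have e1 : ENNReal.ofReal (∫ x in closedBall c (6 * s), (m t x * ‖curl (u t) x‖) ^ α) =
          ∫⁻ x in closedBall c (6 * s), ENNReal.ofReal ((m t x * ‖curl (u t) x‖) ^ α) :=
        ofReal_integral_eq_lintegral_ofReal hint (ae_of_all _ fun x =>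
          Real.rpow_nonneg (mul_nonneg (hm0' t x) (norm_nonneg _)) _)
      have e2 : ∀ x ∈ closedBall c (6 * s), ENNReal.ofReal ((m t x * ‖curl (u t) x‖) ^ α) ≤
          ‖curl (u t) x‖ₑ ^ α * GrujicGuberovic2010.coherenceQuotient γ (2 * R) u t x ^ α := by
        intro x hx
        have hxU : x ∈ ball x₀ (2 * R) := h6cU hx
        have hmx : ENNReal.ofReal (m t x) ≤ GrujicGuberovic2010.coherenceQuotient γ (2 * R) u t x := by
          simp only [hmdef]
          by_cases hx' : x ∈ {y : EuclideanSpace ℝ (Fin 3) | y ∈ ball x₀ (2 * R) ∧ (1 : ℝ) < ‖curl (u t) y‖}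
          · rw [indicator_of_mem hx']
            simp only [hρU, indicator_of_mem hxU]
            exact ENNReal.ofReal_toReal_le
          · rw [indicator_of_notMem hx', ENNReal.ofReal_zero]; exact zero_le
        rw [← ENNReal.ofReal_rpow_of_nonneg (mul_nonneg (hm0' t x) (norm_nonneg _)) hα0.le,
          ENNReal.ofReal_mul (hm0' t x), ofReal_norm, ENNReal.mul_rpow_of_nonneg _ _ hα0.le, mul_comm]
        exact mul_le_mul' le_rfl (ENNReal.rpow_le_rpow hmx hα0.le)
      have hmono : ∫⁻ x in closedBall c (6 * s), ENNReal.ofReal ((m t x * ‖curl (u t) x‖) ^ α) ≤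
          ∫⁻ x in ball x₀ (2 * R), ‖curl (u t) x‖ₑ ^ α *
            GrujicGuberovic2010.coherenceQuotient γ (2 * R) u t x ^ α :=
        (setLIntegral_mono' measurableSet_closedBall e2).trans (lintegral_mono_set h6cU)
      show ENNReal.ofReal ((∫ x in closedBall c (6 * s), (m t x * ‖curl (u t) x‖) ^ α) ^ (1 / (α * θ))) ≤ H t
      rw [he, ← ENNReal.ofReal_rpow_of_nonneg (hNWI0 t) he0, e1, hHdef]
      exact ENNReal.rpow_le_rpow hmono he0
    -- ### the lower integral of the coefficient is finite
    set ah : ℝ → ℝ≥0∞ := fun t => ENNReal.ofReal (acoef t) with hahdef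
    have hah_le : ∀ t ∈ I, ah t ≤ ENNReal.ofReal (αc t) + ENNReal.ofReal A₂ * H t := by
      intro t ht
      show ENNReal.ofReal (αc t + A₂ * NW t) ≤ _
      rw [ENNReal.ofReal_add (hαc0 t) (mul_nonneg hA₂ (hNW0 t)), ENNReal.ofReal_mul hA₂]
      exact add_le_add le_rfl (mul_le_mul' le_rfl (hNWH t ht))
    have hAfin : ∫⁻ t in Ico a t₀, ah t ≠ ⊤ := by
      have h1 : ∫⁻ t in Ico a t₀, ENNReal.ofReal (αc t) < ⊤ := by
        refine lt_of_le_of_lt (lintegral_mono fun t => ?_) hαci.2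
        exact (Real.enorm_eq_ofReal (hαc0 t)).symm.le
      have h2 : ∫⁻ t in Ico a t₀, ENNReal.ofReal A₂ * H t < ⊤ := by
        rw [lintegral_const_mul' _ _ ENNReal.ofReal_ne_top]
        exact ENNReal.mul_lt_top ENNReal.ofReal_lt_top hHint
      have hαcm : AEMeasurable (fun t => ENNReal.ofReal (αc t)) (volume.restrict (Ico a t₀)) :=
        ((hαcc.mono haI).aestronglyMeasurable hIco_meas).aemeasurable.ennreal_ofReal
      have h3 : ∫⁻ t in Ico a t₀, ah t ≤
          (∫⁻ t in Ico a t₀, ENNReal.ofReal (αc t)) + ∫⁻ t in Ico a t₀, ENNReal.ofReal A₂ * H t := by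
        rw [← lintegral_add_left' hαcm]
        exact setLIntegral_mono' hIco_meas fun t ht => hah_le t (haI ht)
      exact ne_top_of_le_ne_top (ENNReal.add_lt_top.2 ⟨h1, h2⟩).ne h3
    -- ### the integral inequality `y(τ) ≤ B + ∫ a y`
    have hyc : ContinuousOn y I := fun t ht => (hder t ht).continuousAt.continuousWithinAt
    set Btot : ℝ := y a + ∫ s' in Ico a t₀, β s' with hBtotdef
    have hBtot0 : 0 ≤ Btot := add_nonneg (hy0 a) (setIntegral_nonneg hIco_meas fun t _ => hβ0 t)
    have hineq : ∀ τ ∈ Ico a t₀, ENNReal.ofReal (y τ) ≤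
        ENNReal.ofReal Btot + ∫⁻ s' in Ioo a τ, ah s' * ENNReal.ofReal (y s') := by
      intro τ hτ
      have hIcc : Icc a τ ⊆ I := fun t ht => haI ⟨ht.1, ht.2.trans_lt hτ.2⟩
      have hsubτ : Ioc a τ ⊆ Ico a t₀ := fun t ht => ⟨ht.1.le, ht.2.trans_lt hτ.2⟩
      -- fundamental theorem of calculus for `y`
      have hDi : IntervalIntegrable D volume a τ :=
        (hDc.mono (by rw [uIcc_of_le hτ.1]; exact hIcc)).intervalIntegrable
      have hftc := intervalIntegral.integral_eq_sub_of_hasDerivAt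
        (fun t ht => hder t (hIcc (by rw [uIcc_of_le hτ.1] at ht; exact ht))) hDi
      rw [intervalIntegral.integral_of_le hτ.1] at hftc
      -- split `D = (D − β) + β`
      have hDI : IntegrableOn D (Ioc a τ) :=
        ((hDc.mono hIcc).integrableOn_compact isCompact_Icc).mono_set Ioc_subset_Icc_self
      have hβI : IntegrableOn β (Ioc a τ) := hβi.mono_set hsubτ
      have hsplit : ∫ t in Ioc a τ, D t = (∫ t in Ioc a τ, (D t - β t)) + ∫ t in Ioc a τ, β t := by
        rw [integral_sub hDI hβI]; ring
      -- the positive part of `D − β` is below `a y`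
      have hpos : IntegrableOn (fun t => max (D t - β t) 0) (Ioc a τ) := by
        have hsub' : ContinuousOn (fun t => D t - β t) (Icc a τ) :=
          (hDc.mono hIcc).sub (hβc.mono hIcc)
        have hc : ContinuousOn (fun t => max (D t - β t) 0) (Icc a τ) :=
          ContinuousOn.sup hsub' continuousOn_const
        exact (hc.integrableOn_compact isCompact_Icc).mono_set Ioc_subset_Icc_self
      have h1 : ∫ t in Ioc a τ, (D t - β t) ≤ ∫ t in Ioc a τ, max (D t - β t) 0 :=
        setIntegral_mono_on (hDI.sub hβI) hpos measurableSet_Ioc fun t _ => le_max_left _ _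
      have h2 : ENNReal.ofReal (∫ t in Ioc a τ, max (D t - β t) 0) ≤
          ∫⁻ t in Ioc a τ, ah t * ENNReal.ofReal (y t) := by
        rw [ofReal_integral_eq_lintegral_ofReal hpos (ae_of_all _ fun t => le_max_right _ _)]
        refine setLIntegral_mono' measurableSet_Ioc fun t ht => ?_
        have htI : t ∈ I := haI (hsubτ ht)
        rw [hahdef, ← ENNReal.ofReal_mul (hacoef0 t)]
        refine ENNReal.ofReal_le_ofReal (max_le ?_ (mul_nonneg (hacoef0 t) (hy0 t)))
        linarith [hle' t htI]
      have h3 : ∫ t in Ioc a τ, β t ≤ ∫ t in Ico a t₀, β t :=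
        setIntegral_mono_set hβi (ae_restrict_of_forall_mem hIco_meas fun t _ => hβ0 t)
          (ae_of_all _ hsubτ)
      have h4 : y τ ≤ Btot + ∫ t in Ioc a τ, max (D t - β t) 0 := by
        have : y τ = y a + ∫ t in Ioc a τ, D t := by linarith
        rw [this, hsplit, hBtotdef]
        linarith
      have h5 : 0 ≤ ∫ t in Ioc a τ, max (D t - β t) 0 :=
        setIntegral_nonneg measurableSet_Ioc fun t _ => le_max_right _ _
      calc ENNReal.ofReal (y τ) ≤ ENNReal.ofReal (Btot + ∫ t in Ioc a τ, max (D t - β t) 0) :=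
            ENNReal.ofReal_le_ofReal h4
        _ = ENNReal.ofReal Btot + ENNReal.ofReal (∫ t in Ioc a τ, max (D t - β t) 0) :=
            ENNReal.ofReal_add hBtot0 h5
        _ ≤ ENNReal.ofReal Btot + ∫⁻ t in Ioc a τ, ah t * ENNReal.ofReal (y t) :=
            add_le_add le_rfl h2
        _ = ENNReal.ofReal Btot + ∫⁻ t in Ioo a τ, ah t * ENNReal.ofReal (y t) := by
            rw [setLIntegral_congr Ioo_ae_eq_Ioc]
    -- ### Grönwall
    set Cfin : ℝ := Btot * Real.exp ((∫⁻ s' in Ico a t₀, ah s').toReal) with hCfin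
    have hgr : ∀ τ ∈ Ico a t₀, y τ ≤ Cfin := by
      intro τ hτ
      have hIcc : Icc a τ ⊆ I := fun t ht => haI ⟨ht.1, ht.2.trans_lt hτ.2⟩
      obtain ⟨By, hBy⟩ := isCompact_Icc.exists_bound_of_continuousOn (hyc.mono hIcc)
      have hsub : Ioo a τ ⊆ Ico a t₀ := fun t ht => ⟨ht.1.le, ht.2.trans hτ.2⟩
      have haτ : ∫⁻ t in Ioo a τ, ah t ≠ ⊤ :=
        ne_top_of_le_ne_top hAfin (lintegral_mono_set hsub)
      have hG := SereginZajaczkowski2007.lintegral_gronwall_le_of_Icc (T₀ := a) (T₁ := τ)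
        (φ := fun t => ENNReal.ofReal (y t)) (a := ah) (B := ENNReal.ofReal Btot)
        (M := ENNReal.ofReal By) ENNReal.ofReal_ne_top ENNReal.ofReal_ne_top
        (fun t ht => ENNReal.ofReal_le_ofReal
          ((le_abs_self _).trans ((Real.norm_eq_abs _).symm.le.trans (hBy t ht))))
        haτ (fun t ht => hineq t ⟨ht.1, ht.2.trans_lt hτ.2⟩) τ ⟨hτ.1, le_rfl⟩
      have hexp : Real.exp ((∫⁻ s' in Ioo a τ, ah s').toReal) ≤
          Real.exp ((∫⁻ s' in Ico a t₀, ah s').toReal) :=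
        Real.exp_le_exp.2 (ENNReal.toReal_mono hAfin (lintegral_mono_set hsub))
      have h2 : ENNReal.ofReal (y τ) ≤ ENNReal.ofReal Cfin := by
        rw [hCfin, ENNReal.ofReal_mul hBtot0]
        exact hG.trans (mul_le_mul' le_rfl (ENNReal.ofReal_le_ofReal hexp))
      exact (ENNReal.ofReal_le_ofReal_iff (by positivity)).1 h2
    refine ⟨Cfin, fun t ht => ?_⟩
    have htI : t ∈ Ico a t₀ := ⟨by have := ht.1; nlinarith, ht.2⟩
    refine le_trans ?_ (hgr t htI)
    -- `∫_{B(c, s/2)} |ω|² ≤ ∫ φ²|ω|²`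
    have hωc : ContinuousOn (fun x => ‖curl (u t) x‖ ^ 2) S :=
      fun x hx => ((hslω t (haI htI) x hx).norm.pow 2)
    have hφS : tsupport φ ⊆ S := hφs.trans ((closedBall_subset_closedBall (by linarith)).trans hcS)
    have hprod : Continuous fun x => φ x ^ 2 * ‖curl (u t) x‖ ^ 2 :=
      continuous_sq_mul_of_continuousOn_cw hS hφc hφS hωc
    have hsupp : HasCompactSupport φ :=
      (isCompact_closedBall c s).of_isClosed_subset (isClosed_tsupport φ) hφs
    have hint : Integrable fun x => φ x ^ 2 * ‖curl (u t) x‖ ^ 2 := by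
      refine hprod.integrable_of_hasCompactSupport (hsupp.mono fun x hx => ?_)
      rw [mem_support] at hx ⊢
      intro h; exact hx (by rw [h]; ring)
    calc ∫ x in ball c (s / 2), ‖curl (u t) x‖ ^ 2
        = ∫ x in ball c (s / 2), φ x ^ 2 * ‖curl (u t) x‖ ^ 2 :=
          setIntegral_congr_fun measurableSet_ball fun x hx => by rw [hφ1 x hx]; ring
      _ ≤ ∫ x, φ x ^ 2 * ‖curl (u t) x‖ ^ 2 :=
          setIntegral_le_integral hint (ae_of_all _ fun x => by positivity)
  -- ### the finite cover of `B̄(x₀, R)`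
  obtain ⟨tc, htc, htcfin, hcover⟩ := finite_cover_balls_of_compact (isCompact_closedBall x₀ R)
    (e := s / 2) (by positivity)
  choose! Cb hCb using key
  refine ⟨∑ c ∈ htcfin.toFinset, Cb c, fun t ht => ?_⟩
  have htI : t ∈ I := ⟨by have := ht.1; nlinarith, ht.2⟩
  have hωc : ContinuousOn (fun x => ‖curl (u t) x‖ ^ 2) S :=
    fun x hx => ((hslω t htI x hx).norm.pow 2)
  have hRS : closedBall x₀ R ⊆ S := fun x hx => by
    rw [mem_closedBall] at hx; rw [hSdef, mem_ball]; linarith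
  have hintR : IntegrableOn (fun x => ‖curl (u t) x‖ ^ 2) (ball x₀ R) :=
    ((hωc.mono hRS).integrableOn_compact (isCompact_closedBall x₀ R)).mono_set ball_subset_closedBall
  have hintc : ∀ c ∈ htcfin.toFinset, IntegrableOn (fun x => ‖curl (u t) x‖ ^ 2) (ball c (s / 2)) := by
    intro c hc
    have hc' : c ∈ closedBall x₀ R := htc (htcfin.mem_toFinset.1 hc)
    rw [mem_closedBall] at hc'
    have hsub : closedBall c (s / 2) ⊆ S := fun x hx => by
      rw [mem_closedBall] at hx; rw [hSdef, mem_ball]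
      calc dist x x₀ ≤ dist x c + dist c x₀ := dist_triangle _ _ _
        _ < 4 * R := by rw [hsdef] at hx; linarith
    exact ((hωc.mono hsub).integrableOn_compact (isCompact_closedBall c (s / 2))).mono_set
      ball_subset_closedBall
  have hpt : ∀ x, (ball x₀ R).indicator (fun x => ‖curl (u t) x‖ ^ 2) x ≤
      ∑ c ∈ htcfin.toFinset, (ball c (s / 2)).indicator (fun x => ‖curl (u t) x‖ ^ 2) x := by
    intro x
    by_cases hx : x ∈ ball x₀ R
    · rw [indicator_of_mem hx]
      obtain ⟨c, hc, hxc⟩ : ∃ c ∈ tc, x ∈ ball c (s / 2) := by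
        have := hcover (ball_subset_closedBall hx)
        simpa only [mem_iUnion, exists_prop] using this
      have hcmem : c ∈ htcfin.toFinset := htcfin.mem_toFinset.2 hc
      refine le_trans (le_of_eq (indicator_of_mem hxc (fun x => ‖curl (u t) x‖ ^ 2)).symm) ?_
      exact Finset.single_le_sum (f := fun c => (ball c (s / 2)).indicator (fun x => ‖curl (u t) x‖ ^ 2) x)
        (fun c _ => indicator_nonneg (fun y _ => by positivity) _) hcmem
    · rw [indicator_of_notMem hx]
      exact Finset.sum_nonneg fun c _ => indicator_nonneg (fun y _ => by positivity) _
  have hIind : Integrable fun x => (ball x₀ R).indicator (fun x => ‖curl (u t) x‖ ^ 2) x :=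
    (integrable_indicator_iff measurableSet_ball).2 hintR
  have hIsum : Integrable fun x =>
      ∑ c ∈ htcfin.toFinset, (ball c (s / 2)).indicator (fun x => ‖curl (u t) x‖ ^ 2) x :=
    integrable_finsetSum _ fun c hc => (integrable_indicator_iff measurableSet_ball).2 (hintc c hc)
  calc ∫ x in ball x₀ R, ‖curl (u t) x‖ ^ 2
      = ∫ x, (ball x₀ R).indicator (fun x => ‖curl (u t) x‖ ^ 2) x :=
        (integral_indicator measurableSet_ball).symm
    _ ≤ ∫ x, ∑ c ∈ htcfin.toFinset, (ball c (s / 2)).indicator (fun x => ‖curl (u t) x‖ ^ 2) x :=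
        integral_mono hIind hIsum hpt
    _ = ∑ c ∈ htcfin.toFinset, ∫ x, (ball c (s / 2)).indicator (fun x => ‖curl (u t) x‖ ^ 2) x :=
        integral_finsetSum _ fun c hc => (integrable_indicator_iff measurableSet_ball).2 (hintc c hc)
    _ = ∑ c ∈ htcfin.toFinset, ∫ x in ball c (s / 2), ‖curl (u t) x‖ ^ 2 :=
        Finset.sum_congr rfl fun c _ => integral_indicator measurableSet_ball
    _ ≤ ∑ c ∈ htcfin.toFinset, Cb c :=
        Finset.sum_le_sum fun c hc => hCb c (htc (htcfin.mem_toFinset.1 hc)) t ht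


/-! ### The printed generality: smoothness on `Q_{2R}(x₀, t₀)` only -/

/-- Variant of `coherenceQuotient_le_of_lipschitz_cw` with free radii: if `ω(t)` is `L`-Lipschitz on
`B(x₀, ρ_L)`, `y ∈ B(x₀, ρ_y)` with `ρ_y + d₀ ≤ ρ_L`, `|ω(y,t)| > Ω > 0` and `0 < γ ≤ 1`, then
`ρ_{γ,r}(y,t) ≤ max (2Ld₀^{1−γ}/Ω, d₀^{−γ})` for every `r` (near pairs `|y − z| < d₀` by the
Lipschitz bound of the direction, far pairs by `|ξ(y) × ξ(z)| ≤ 1`).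
[cite: GrujicGuberovic2010, §1 p. 410 (definition of `ρ_{γ,r}`)] -/
private theorem coherenceQuotient_le_of_lipschitz_gen_cw {γ r d₀ ρL ρy L Ω : ℝ} (hγ0 : 0 < γ)
    (hγ1 : γ ≤ 1) (hd₀ : 0 < d₀) (hρ : ρy + d₀ ≤ ρL) (hL : 0 ≤ L) (hΩ : 0 < Ω)
    {u : ℝ → (EuclideanSpace ℝ (Fin 3)) → (EuclideanSpace ℝ (Fin 3))} {t : ℝ}
    {x₀ y : EuclideanSpace ℝ (Fin 3)}
    (hLip : ∀ a ∈ ball x₀ ρL, ∀ b ∈ ball x₀ ρL, ‖curl (u t) b - curl (u t) a‖ ≤ L * ‖b - a‖)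
    (hy : y ∈ ball x₀ ρy) (hΩy : Ω < ‖curl (u t) y‖) :
    GrujicGuberovic2010.coherenceQuotient γ r u t y ≤
      ENNReal.ofReal (max (2 * L * d₀ ^ (1 - γ) / Ω) (d₀ ^ (-γ))) := by
  unfold GrujicGuberovic2010.coherenceQuotient
  refine iSup_le fun z => iSup_le fun _ => iSup_le fun hzy => ENNReal.ofReal_le_ofReal ?_
  set ξ := vorticityDirection (curl (u t)) with hξ
  have hy0 : curl (u t) y ≠ 0 := fun h => by rw [h, norm_zero] at hΩy; exact lt_irrefl _ (hΩ.trans hΩy)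
  have hξy : ‖ξ y‖ = 1 := norm_vorticityDirection _ hy0
  have hd0 : 0 < ‖y - z‖ := norm_pos_iff.2 (sub_ne_zero.2 (Ne.symm hzy))
  have hdγ : 0 < ‖y - z‖ ^ γ := Real.rpow_pos_of_pos hd0 γ
  by_cases hd : ‖y - z‖ < d₀
  · have hz3 : z ∈ ball x₀ ρL := by
      rw [mem_ball] at hy ⊢
      calc dist z x₀ ≤ dist z y + dist y x₀ := dist_triangle _ _ _
        _ < d₀ + ρy := by
            rw [dist_eq_norm, ← norm_neg, neg_sub]; exact add_lt_add hd hy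
        _ ≤ ρL := by linarith
    have hy3 : y ∈ ball x₀ ρL := by
      rw [mem_ball] at hy ⊢; linarith
    have h1 : ‖cross (ξ y) (ξ z)‖ ≤ ‖ξ z - ξ y‖ := norm_cross_le_norm_sub_cw _ hξy
    have h2 : ‖ξ z - ξ y‖ ≤ 2 * ‖curl (u t) z - curl (u t) y‖ / ‖curl (u t) y‖ :=
      norm_vorticityDirection_sub_le_cw hy0 z
    have h3 : ‖curl (u t) z - curl (u t) y‖ ≤ L * ‖y - z‖ := by
      have h := hLip y hy3 z hz3
      rwa [norm_sub_rev z y] at h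
    have h4 : ‖cross (ξ y) (ξ z)‖ ≤ 2 * L * ‖y - z‖ / Ω := by
      have h23 : 2 * ‖curl (u t) z - curl (u t) y‖ / ‖curl (u t) y‖ ≤ 2 * (L * ‖y - z‖) / Ω := by
        have hn : 0 ≤ 2 * ‖curl (u t) z - curl (u t) y‖ := by positivity
        calc 2 * ‖curl (u t) z - curl (u t) y‖ / ‖curl (u t) y‖
            ≤ 2 * ‖curl (u t) z - curl (u t) y‖ / Ω :=
              div_le_div_of_nonneg_left hn hΩ hΩy.le
          _ ≤ 2 * (L * ‖y - z‖) / Ω := by gcongr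
      calc ‖cross (ξ y) (ξ z)‖ ≤ 2 * (L * ‖y - z‖) / Ω := h1.trans (h2.trans h23)
        _ = 2 * L * ‖y - z‖ / Ω := by ring
    have h5 : ‖y - z‖ / ‖y - z‖ ^ γ = ‖y - z‖ ^ (1 - γ) := by
      rw [Real.rpow_sub hd0, Real.rpow_one]
    have h6 : ‖y - z‖ ^ (1 - γ) ≤ d₀ ^ (1 - γ) :=
      Real.rpow_le_rpow hd0.le hd.le (by linarith)
    calc ‖cross (ξ y) (ξ z)‖ / ‖y - z‖ ^ γ ≤ (2 * L * ‖y - z‖ / Ω) / ‖y - z‖ ^ γ :=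
          div_le_div_of_nonneg_right h4 hdγ.le
      _ = 2 * L / Ω * (‖y - z‖ / ‖y - z‖ ^ γ) := by ring
      _ = 2 * L / Ω * ‖y - z‖ ^ (1 - γ) := by rw [h5]
      _ ≤ 2 * L / Ω * d₀ ^ (1 - γ) := by gcongr
      _ = 2 * L * d₀ ^ (1 - γ) / Ω := by ring
      _ ≤ max (2 * L * d₀ ^ (1 - γ) / Ω) (d₀ ^ (-γ)) := le_max_left _ _
  · rw [not_lt] at hd
    have h1 : ‖cross (ξ y) (ξ z)‖ ≤ 1 := by
      calc ‖cross (ξ y) (ξ z)‖ ≤ ‖ξ y‖ * ‖ξ z‖ := norm_cross_le_mul_cw _ _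
        _ ≤ 1 * 1 := mul_le_mul hξy.le (norm_vorticityDirection_le_one_cw _ _) (norm_nonneg _) zero_le_one
        _ = 1 := one_mul _
    have hRγ : 0 < d₀ ^ γ := Real.rpow_pos_of_pos hd₀ γ
    calc ‖cross (ξ y) (ξ z)‖ / ‖y - z‖ ^ γ ≤ 1 / ‖y - z‖ ^ γ :=
          div_le_div_of_nonneg_right h1 hdγ.le
      _ ≤ 1 / d₀ ^ γ := one_div_le_one_div_of_le hRγ (Real.rpow_le_rpow hd₀.le hd hγ0.le)
      _ = d₀ ^ (-γ) := by rw [Real.rpow_neg hd₀.le, one_div]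
      _ ≤ max (2 * L * d₀ ^ (1 - γ) / Ω) (d₀ ^ (-γ)) := le_max_right _ _

set_option maxHeartbeats 1600000 in
/-- **Grujić–Guberović 2010, Theorem 2 in the printed generality: smoothness on `Q_{2R}(x₀, t₀)`
only.** The named fact `grujicGuberovic2010_coherenceWeighted_criterion` asks for smoothness on
`(t₀ − (2R)², t₀) × B(x₀, 4R)` so that only classical vorticity directions enter the coherence
measure `ρ_{γ,2R}` (its supremum ranges over `y ∈ B(x, 2R) ⊆ B(x₀, 4R)`); the printed hypothesis is
"`u` is smooth in `Q_{2R}(x₀, t₀)`" (p. 415). The proof above only pairs points at distance `< R/4`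
inside `B(x₀, 7R/4)` (the far pairs being bounded by `|ξ × ξ'| ≤ 1`), so it goes through verbatim
under the printed hypothesis, with the coherence measure `GrujicGuberovic2010.coherenceQuotient` as
defined (junk value `ξ = 0`, hence zero quotient, at points where the slice is not differentiable —
which only weakens the hypothesis). Also the hypotheses `0 < T` and `R < 1` of the fact are dropped.
This closes the `TODO(general form)` recorded at the fact. [cite: GrujicGuberovic2010, Thm. 2 (p. 415) with its proof pp. 415–417] -/
theorem grujicGuberovic2010_coherenceWeighted_criterion_of_smooth_Q2R {T : ℝ}
    {u₀ : (EuclideanSpace ℝ (Fin 3)) → (EuclideanSpace ℝ (Fin 3))}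
    {u : ℝ → (EuclideanSpace ℝ (Fin 3)) → (EuclideanSpace ℝ (Fin 3))}
    (hLH : IsLerayHopfOn T 1 0 u₀ u) (x₀ : EuclideanSpace ℝ (Fin 3)) {t₀ R γ α : ℝ} (hR : 0 < R)
    (ht₀ : (2 * R) ^ 2 ≤ t₀) (ht₀T : t₀ < T) (hγ0 : 0 < γ) (hγ1 : γ < 1) (hαlo : 3 / (γ + 2) < α)
    (hαhi : α < 3 / γ)
    (hsm : ContDiffOn ℝ (⊤ : ℕ∞) (uncurry u) (Ioo (t₀ - (2 * R) ^ 2) t₀ ×ˢ ball x₀ (2 * R)))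
    (hi : ∫⁻ t in Ioo (t₀ - (2 * R) ^ 2) t₀,
        (∫⁻ x in ball x₀ (2 * R),
            ‖curl (u t) x‖ₑ ^ α *
              GrujicGuberovic2010.coherenceQuotient γ (2 * R) u t x ^ α) ^
          (2 / ((2 + γ) * α - 3)) < (⊤ : ℝ≥0∞)) :
    ∃ C : ℝ, ∀ t ∈ Ioo (t₀ - R ^ 2) t₀, ∫ x in ball x₀ R, ‖curl (u t) x‖ ^ 2 ≤ C := by
  -- ### exponents (Hölder exponent `γ`, Lebesgue exponent `α` in the notation of the bricks)
  have hγ2 : 0 < γ + 2 := by linarith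
  have h3α : 3 < α * (γ + 2) := by
    have h := hαlo; rw [div_lt_iff₀ hγ2] at h; exact h
  have hα1 : 1 < α := by nlinarith
  have hα0 : 0 < α := by linarith
  have hγα : γ * α < 3 := by
    have h := hαhi; rw [lt_div_iff₀ hγ0] at h; linarith
  have hup : 1 / α < (2 + γ) / 3 := by
    rw [div_lt_div_iff₀ hα0 (by norm_num : (0 : ℝ) < 3)]; linarith
  set θ : ℝ := 1 + γ / 2 - 3 / 2 * (1 / α) with hθdef
  have hden : 0 < (2 + γ) * α - 3 := by linarith
  have hαθ : α * θ = ((2 + γ) * α - 3) / 2 := by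
    rw [hθdef]; field_simp
  have he : 1 / (α * θ) = 2 / ((2 + γ) * α - 3) := by
    rw [hαθ, one_div_div]
  have he0 : 0 ≤ 2 / ((2 + γ) * α - 3) := by positivity
  have he0' : 0 ≤ 1 / (α * θ) := by rw [he]; exact he0
  -- ### the cylinder of smoothness
  set I : Set ℝ := Ioo (t₀ - (2 * R) ^ 2) t₀ with hIdef
  set S : Set (EuclideanSpace ℝ (Fin 3)) := ball x₀ (2 * R) with hSdef
  have hI : IsOpen I := isOpen_Ioo
  have hS : IsOpen S := isOpen_ball
  have hIT : I ⊆ Ioo 0 T := fun t ht => ⟨by have := ht.1; nlinarith, ht.2.trans ht₀T⟩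
  have hu : ContDiffOn ℝ ∞ (uncurry u) (I ×ˢ S) := hsm
  obtain ⟨-, -, hDU, hω0, -, -, -⟩ := hLH.vorticity_classical_of_contDiffOn hI hS hIT hu
  have hpmk : ∀ t : ℝ, Continuous (fun x : (EuclideanSpace ℝ (Fin 3)) => ((t, x) : ℝ × (EuclideanSpace ℝ (Fin 3)))) :=
    fun t => continuous_const.prodMk continuous_id
  have hslDU : ∀ t ∈ I, ContinuousOn (fun x => fderiv ℝ (u t) x) S := fun t ht =>
    hDU.comp (hpmk t).continuousOn fun x hx => ⟨ht, hx⟩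
  have hslω : ∀ t ∈ I, ContinuousOn (fun x => curl (u t) x) S := fun t ht =>
    hω0.comp (hpmk t).continuousOn fun x hx => ⟨ht, hx⟩
  have h2RS : ball x₀ (2 * R) ⊆ S := ball_subset_ball (by linarith)
  have h3RS : closedBall x₀ (7 * R / 4) ⊆ S := closedBall_subset_ball (by linarith)
  have h32S : ball x₀ (3 * R / 2) ⊆ S := ball_subset_ball (by linarith)
  have h32 : ball x₀ (3 * R / 2) ⊆ ball x₀ (2 * R) := ball_subset_ball (by linarith)
  -- ### the coherence weight on the slices: measurable, nonnegative, bounded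
  set ρU : ℝ → (EuclideanSpace ℝ (Fin 3)) → ℝ≥0∞ := fun t =>
    (ball x₀ (2 * R)).indicator (GrujicGuberovic2010.coherenceQuotient γ (2 * R) u t) with hρU
  have hρUm : ∀ t ∈ I, Measurable (ρU t) := fun t ht =>
    measurable_indicator_coherenceQuotient_cw hγ0 isOpen_ball hS h2RS (hslω t ht)
  have hLip : ∀ t ∈ I, ∃ L : ℝ, 0 ≤ L ∧ ∀ a ∈ ball x₀ (7 * R / 4), ∀ b ∈ ball x₀ (7 * R / 4),
      ‖curl (u t) b - curl (u t) a‖ ≤ L * ‖b - a‖ := fun t ht =>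
    exists_lipschitz_curl_slice_cw hS hu h3RS ht
  set m : ℝ → (EuclideanSpace ℝ (Fin 3)) → ℝ := fun t y =>
    ({y : EuclideanSpace ℝ (Fin 3) | y ∈ ball x₀ (3 * R / 2) ∧ (1 : ℝ) < ‖curl (u t) y‖}).indicator
      (fun y => (ρU t y).toReal) y with hmdef
  have hm0' : ∀ t y, 0 ≤ m t y := fun t y => by
    simp only [hmdef]
    exact indicator_nonneg (fun _ _ => ENNReal.toReal_nonneg) _
  have hm0 : ∀ t ∈ I, ∀ y, 0 ≤ m t y := fun t _ y => hm0' t y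
  have hmm : ∀ t ∈ I, Measurable (m t) := by
    intro t ht
    have hO : IsOpen {y : EuclideanSpace ℝ (Fin 3) | y ∈ ball x₀ (3 * R / 2) ∧ (1 : ℝ) < ‖curl (u t) y‖} := by
      have h' : IsOpen (S ∩ (fun x => ‖curl (u t) x‖) ⁻¹' Ioi 1) :=
        (hslω t ht).norm.isOpen_inter_preimage hS isOpen_Ioi
      have e : {y : EuclideanSpace ℝ (Fin 3) | y ∈ ball x₀ (3 * R / 2) ∧ (1 : ℝ) < ‖curl (u t) y‖} =
          ball x₀ (3 * R / 2) ∩ (S ∩ (fun x => ‖curl (u t) x‖) ⁻¹' Ioi 1) := by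
        ext y
        simp only [mem_setOf_eq, mem_inter_iff, mem_preimage, mem_Ioi]
        exact ⟨fun h => ⟨h.1, h32S h.1, h.2⟩, fun h => ⟨h.1, h.2.2⟩⟩
      rw [e]; exact isOpen_ball.inter h'
    exact (hρUm t ht).ennreal_toReal.indicator hO.measurableSet
  have hR4 : 0 < R / 4 := by positivity
  have hρle : ∀ t ∈ I, ∃ B : ℝ, 0 ≤ B ∧ ∀ y ∈ ball x₀ (3 * R / 2), (1 : ℝ) < ‖curl (u t) y‖ →
      GrujicGuberovic2010.coherenceQuotient γ (2 * R) u t y ≤ ENNReal.ofReal B := by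
    intro t ht
    obtain ⟨L, hL0, hL⟩ := hLip t ht
    refine ⟨max (2 * L * (R / 4) ^ (1 - γ) / 1) ((R / 4) ^ (-γ)),
      le_max_of_le_right (Real.rpow_nonneg hR4.le _), fun y hy h1y => ?_⟩
    exact coherenceQuotient_le_of_lipschitz_gen_cw hγ0 hγ1.le hR4 (by linarith) hL0 one_pos hL hy h1y
  have hmb : ∀ t ∈ I, ∃ Mb : ℝ, ∀ y, m t y ≤ Mb := by
    intro t ht
    obtain ⟨B, hB0, hB⟩ := hρle t ht
    refine ⟨B, fun y => ?_⟩
    simp only [hmdef]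
    by_cases hy : y ∈ {y : EuclideanSpace ℝ (Fin 3) | y ∈ ball x₀ (3 * R / 2) ∧ (1 : ℝ) < ‖curl (u t) y‖}
    · rw [indicator_of_mem hy]
      have e : ρU t y = GrujicGuberovic2010.coherenceQuotient γ (2 * R) u t y := by
        simp only [hρU, indicator_of_mem (h32 hy.1)]
      rw [e]
      exact ENNReal.toReal_le_of_le_ofReal hB0 (hB y hy.1 hy.2)
    · rw [indicator_of_notMem hy]; exact hB0
  -- the weight realises the coherence hypothesis of the bricks on every small ball inside `B(x₀, 2R)`
  set s : ℝ := R / 16 with hsdef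
  have hs : 0 < s := by positivity
  have hdirI : ∀ c : EuclideanSpace ℝ (Fin 3), ball c (6 * s) ⊆ ball x₀ (3 * R / 2) →
      ∀ t ∈ I, ∀ x ∈ ball c (6 * s), ∀ y ∈ ball c (6 * s),
        (1 : ℝ) < ‖curl (u t) x‖ → (1 : ℝ) < ‖curl (u t) y‖ →
          Real.sqrt (1 - ⟪vorticityDirection (curl (u t)) x, vorticityDirection (curl (u t)) y⟫ ^ 2) ≤
            m t y * ‖x - y‖ ^ γ := by
    intro c hc6 t ht x hx y hy h1x h1y
    have hx0 : curl (u t) x ≠ 0 := fun h => by rw [h, norm_zero] at h1x; linarith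
    have hy0 : curl (u t) y ≠ 0 := fun h => by rw [h, norm_zero] at h1y; linarith
    have hy32 : y ∈ ball x₀ (3 * R / 2) := hc6 hy
    have hyU : y ∈ ball x₀ (2 * R) := h32 hy32
    have hmem : y ∈ {y : EuclideanSpace ℝ (Fin 3) | y ∈ ball x₀ (3 * R / 2) ∧ (1 : ℝ) < ‖curl (u t) y‖} :=
      ⟨hy32, h1y⟩
    have hmy : m t y = (GrujicGuberovic2010.coherenceQuotient γ (2 * R) u t y).toReal := by
      simp only [hmdef, indicator_of_mem hmem, hρU, indicator_of_mem hyU]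
    obtain ⟨B, hB0, hB⟩ := hρle t ht
    have hρfin : GrujicGuberovic2010.coherenceQuotient γ (2 * R) u t y ≠ ⊤ :=
      ne_top_of_le_ne_top ENNReal.ofReal_ne_top (hB y hy32 h1y)
    by_cases hxy : x = y
    · subst hxy
      have e1 : ⟪vorticityDirection (curl (u t)) x, vorticityDirection (curl (u t)) x⟫ = 1 := by
        rw [real_inner_self_eq_norm_sq, norm_vorticityDirection _ hx0, one_pow]
      simp only [e1, one_pow, sub_self, Real.sqrt_zero, norm_zero, Real.zero_rpow hγ0.ne', mul_zero,
        le_refl]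
    have hxball : x ∈ ball y (2 * R) := by
      rw [mem_ball] at hx hy ⊢
      calc dist x y ≤ dist x c + dist y c := dist_triangle_right _ _ _
        _ < 6 * s + 6 * s := add_lt_add hx hy
        _ < 2 * R := by rw [hsdef]; linarith
    have hq := ofReal_div_le_coherenceQuotient_cw (u := u) (t := t) (γ := γ) hxball hxy
    have hreal : ‖cross (vorticityDirection (curl (u t)) y) (vorticityDirection (curl (u t)) x)‖ /
        ‖y - x‖ ^ γ ≤ m t y := by
      rw [hmy]; exact (ENNReal.ofReal_le_iff_le_toReal hρfin).1 hq
    have hpos : 0 < ‖y - x‖ ^ γ :=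
      Real.rpow_pos_of_pos (norm_pos_iff.2 (sub_ne_zero.2 (Ne.symm hxy))) γ
    calc Real.sqrt (1 - ⟪vorticityDirection (curl (u t)) x, vorticityDirection (curl (u t)) y⟫ ^ 2)
        = ‖cross (vorticityDirection (curl (u t)) y) (vorticityDirection (curl (u t)) x)‖ := by
          rw [← real_inner_comm, norm_cross_eq_sqrt_one_sub_inner_sq
            (norm_vorticityDirection _ hy0) (norm_vorticityDirection _ hx0)]
      _ = ‖cross (vorticityDirection (curl (u t)) y) (vorticityDirection (curl (u t)) x)‖ /
            ‖y - x‖ ^ γ * ‖y - x‖ ^ γ := by rw [div_mul_cancel₀ _ hpos.ne']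
      _ ≤ m t y * ‖y - x‖ ^ γ := mul_le_mul_of_nonneg_right hreal hpos.le
      _ = m t y * ‖x - y‖ ^ γ := by rw [norm_sub_rev]
  -- ### the time `a` and the energy bound
  set a : ℝ := t₀ - 2 * R ^ 2 with hadef
  have haI : Ico a t₀ ⊆ I := fun t ht => ⟨by have := ht.1; nlinarith, ht.2⟩
  have ha : a ∈ I := haI ⟨le_rfl, by nlinarith⟩
  have hIfin : volume (Ico a t₀) < ⊤ := measure_Ico_lt_top
  have hIco_meas : MeasurableSet (Ico a t₀) := measurableSet_Ico
  set E₀ : ℝ := 2 * VectorCalculus.kineticEnergy u₀ with hE₀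
  have hEbound : ∀ t ∈ I, ∀ A : Set (EuclideanSpace ℝ (Fin 3)), ∫ x in A, ‖u t x‖ ^ 2 ≤ E₀ := fun t ht A =>
    hLH.setIntegral_norm_sq_le_cw zero_le_one ⟨(hIT ht).1.le, (hIT ht).2.le⟩ A
  -- the hypothesis, as a function of time
  set H : ℝ → ℝ≥0∞ := fun t =>
    (∫⁻ x in ball x₀ (2 * R), ‖curl (u t) x‖ₑ ^ α *
        GrujicGuberovic2010.coherenceQuotient γ (2 * R) u t x ^ α) ^ (2 / ((2 + γ) * α - 3)) with hHdef
  have hHint : ∫⁻ t in Ico a t₀, H t < ⊤ := lt_of_le_of_lt (lintegral_mono_set haI) hi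
  -- ### the bound on one small ball
  have key : ∀ c ∈ closedBall x₀ R, ∃ Cc : ℝ, ∀ t ∈ Ioo (t₀ - R ^ 2) t₀,
      ∫ x in ball c (s / 2), ‖curl (u t) x‖ ^ 2 ≤ Cc := by
    intro c hc
    rw [mem_closedBall] at hc
    have hcS : closedBall c (12 * s) ⊆ S := fun x hx => by
      rw [mem_closedBall] at hx
      rw [hSdef, mem_ball]
      calc dist x x₀ ≤ dist x c + dist c x₀ := dist_triangle _ _ _
        _ < 2 * R := by rw [hsdef] at hx; linarith
    have hc6 : ball c (6 * s) ⊆ ball x₀ (3 * R / 2) := fun x hx => by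
      rw [mem_ball] at hx ⊢
      calc dist x x₀ ≤ dist x c + dist c x₀ := dist_triangle _ _ _
        _ < 3 * R / 2 := by rw [hsdef] at hx; linarith
    have h6cU : closedBall c (6 * s) ⊆ ball x₀ (2 * R) := fun x hx => by
      rw [mem_closedBall] at hx; rw [mem_ball]
      calc dist x x₀ ≤ dist x c + dist c x₀ := dist_triangle _ _ _
        _ < 2 * R := by rw [hsdef] at hx; linarith
    have h6cS : closedBall c (6 * s) ⊆ S := h6cU.trans h2RS
    obtain ⟨φ, D, A₀, A₁, A₂, B₀, B₁, hφ1, hφ01, hA₀, hA₁, hA₂, hB₀, hB₁, hφc, hφs, hYc, hFc, hEc,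
      hDc, hder, hle⟩ :=
      hLH.exists_weight_localEnstrophy_deriv_le_holderWeight one_pos hI hS hIT hu c hs hcS hγ0 hα1 hγα
        hup hθdef one_pos hmm hm0 hmb (hdirI c hc6)
    -- names for the local sizes
    set Y : ℝ → ℝ := fun t => ∫ x in closedBall c (6 * s), ‖curl (u t) x‖ ^ 2 with hYdef
    set F : ℝ → ℝ := fun t => ∫ x in closedBall c (6 * s), ‖fderiv ℝ (u t) x‖ ^ 2 with hFdef
    set E : ℝ → ℝ := fun t => ∫ x in closedBall c (6 * s), ‖u t x‖ ^ 2 with hEdef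
    set NW : ℝ → ℝ := fun t =>
      (∫ x in closedBall c (6 * s), (m t x * ‖curl (u t) x‖) ^ α) ^ (1 / (α * θ)) with hNWdef
    set y : ℝ → ℝ := fun t => ∫ x, φ x ^ 2 * ‖curl (u t) x‖ ^ 2 with hydef
    have hY0 : ∀ t, 0 ≤ Y t := fun t => setIntegral_nonneg measurableSet_closedBall fun x _ => by positivity
    have hF0 : ∀ t, 0 ≤ F t := fun t => setIntegral_nonneg measurableSet_closedBall fun x _ => by positivity
    have hE0 : ∀ t, 0 ≤ E t := fun t => setIntegral_nonneg measurableSet_closedBall fun x _ => by positivity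
    have hNWI0 : ∀ t, 0 ≤ ∫ x in closedBall c (6 * s), (m t x * ‖curl (u t) x‖) ^ α := fun t =>
      setIntegral_nonneg measurableSet_closedBall fun x _ =>
        Real.rpow_nonneg (mul_nonneg (hm0' t x) (norm_nonneg _)) _
    have hNW0 : ∀ t, 0 ≤ NW t := fun t => Real.rpow_nonneg (hNWI0 t) _
    have hy0 : ∀ t, 0 ≤ y t := fun t => integral_nonneg fun x => by positivity
    have hEle : ∀ t ∈ I, E t ≤ E₀ := fun t ht => hEbound t ht _
    -- `Y ≤ ‖curlCLM‖² F`
    have hYF : ∀ t ∈ I, Y t ≤ ‖curlCLM‖ ^ 2 * F t := by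
      intro t ht
      have hcont : ContinuousOn (fun x => ‖fderiv ℝ (u t) x‖ ^ 2) (closedBall c (6 * s)) :=
        fun x hx => ((hslDU t ht x (h6cS hx)).norm.pow 2).mono h6cS
      have hint : IntegrableOn (fun x => ‖fderiv ℝ (u t) x‖ ^ 2) (closedBall c (6 * s)) :=
        hcont.integrableOn_compact (isCompact_closedBall _ _)
      calc Y t ≤ ∫ x in closedBall c (6 * s), ‖curlCLM‖ ^ 2 * ‖fderiv ℝ (u t) x‖ ^ 2 := by
            refine setIntegral_mono_on ?_ (hint.const_mul _) measurableSet_closedBall fun x _ => ?_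
            · have hc2 : ContinuousOn (fun x => ‖curl (u t) x‖ ^ 2) (closedBall c (6 * s)) :=
                fun x hx => ((hslω t ht x (h6cS hx)).norm.pow 2).mono h6cS
              exact hc2.integrableOn_compact (isCompact_closedBall _ _)
            · rw [curl_eq_curlCLM, ← mul_pow]
              exact pow_le_pow_left₀ (norm_nonneg _) (ContinuousLinearMap.le_opNorm _ _) 2
        _ = ‖curlCLM‖ ^ 2 * F t := integral_const_mul _ _
    -- integrability of the continuous coefficients on `[a, t₀)`
    have hFi : IntegrableOn F (Ico a t₀) :=
      (hLH.integrableOn_localGradSq_cw hI hS hIT hu h6cS hFc).mono_set haI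
    have hYi : IntegrableOn Y (Ico a t₀) := by
      refine Integrable.mono' (hFi.const_mul (‖curlCLM‖ ^ 2))
        ((hYc.mono haI).aestronglyMeasurable hIco_meas) ?_
      refine ae_restrict_of_forall_mem hIco_meas fun t ht => ?_
      rw [Real.norm_of_nonneg (hY0 t)]
      exact hYF t (haI ht)
    have hEi : IntegrableOn E (Ico a t₀) := by
      refine Integrable.mono' (integrableOn_const (C := E₀) (hs := hIfin.ne))
        ((hEc.mono haI).aestronglyMeasurable hIco_meas) ?_
      refine ae_restrict_of_forall_mem hIco_meas fun t ht => ?_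
      rw [Real.norm_of_nonneg (hE0 t)]
      exact hEle t (haI ht)
    set αc : ℝ → ℝ := fun t => A₀ + A₁ * (Y t + F t + E t) with hαcdef
    set β : ℝ → ℝ := fun t => (B₀ + B₁ * E t ^ 2) * (Y t + F t) with hβdef
    have hαcc : ContinuousOn αc I := continuousOn_const.add (continuousOn_const.mul ((hYc.add hFc).add hEc))
    have hβc : ContinuousOn β I := (continuousOn_const.add (continuousOn_const.mul (hEc.pow 2))).mul (hYc.add hFc)
    have hαc0 : ∀ t, 0 ≤ αc t := fun t => by
      have := hY0 t; have := hF0 t; have := hE0 t; positivity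
    have hβ0 : ∀ t, 0 ≤ β t := fun t => by
      have := hY0 t; have := hF0 t; have := hE0 t; positivity
    have hαci : IntegrableOn αc (Ico a t₀) :=
      (integrableOn_const (C := A₀) (hs := hIfin.ne)).add (((hYi.add hFi).add hEi).const_mul A₁)
    have hβi : IntegrableOn β (Ico a t₀) := by
      refine Integrable.mono' (((hYi.add hFi)).const_mul (B₀ + B₁ * E₀ ^ 2))
        ((hβc.mono haI).aestronglyMeasurable hIco_meas) ?_
      refine ae_restrict_of_forall_mem hIco_meas fun t ht => ?_
      rw [Real.norm_of_nonneg (hβ0 t)]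
      have h1 : E t ^ 2 ≤ E₀ ^ 2 := pow_le_pow_left₀ (hE0 t) (hEle t (haI ht)) 2
      have h2 : 0 ≤ Y t + F t := add_nonneg (hY0 t) (hF0 t)
      show (B₀ + B₁ * E t ^ 2) * (Y t + F t) ≤ (B₀ + B₁ * E₀ ^ 2) * (Y t + F t)
      exact mul_le_mul_of_nonneg_right (by nlinarith) h2
    -- the full coefficient `αc + A₂ NW` and the differential inequality
    set acoef : ℝ → ℝ := fun t => αc t + A₂ * NW t with hacoefdef
    have hacoef0 : ∀ t, 0 ≤ acoef t := fun t => add_nonneg (hαc0 t) (mul_nonneg hA₂ (hNW0 t))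
    have hle' : ∀ t ∈ I, D t ≤ acoef t * y t + β t := fun t ht => hle t ht
    -- ### the Grönwall weight is dominated by the hypothesis
    have hNWH : ∀ t ∈ I, ENNReal.ofReal (NW t) ≤ H t := by
      intro t ht
      obtain ⟨Mb, hMb⟩ := hmb t ht
      have hMb0 : 0 ≤ Mb := (hm0' t x₀).trans (hMb x₀)
      have hωc : ContinuousOn (fun x => curl (u t) x) (closedBall c (6 * s)) := (hslω t ht).mono h6cS
      obtain ⟨Bω, hBω⟩ := (isCompact_closedBall c (6 * s)).exists_bound_of_continuousOn hωc
      have hBω0 : 0 ≤ Bω := (norm_nonneg _).trans (hBω c (mem_closedBall_self (by positivity)))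
      have hmeas : AEStronglyMeasurable (fun x => (m t x * ‖curl (u t) x‖) ^ α)
          (volume.restrict (closedBall c (6 * s))) := by
        have h1 : AEMeasurable (m t) (volume.restrict (closedBall c (6 * s))) :=
          (hmm t ht).aemeasurable
        have h2 : AEMeasurable (fun x => ‖curl (u t) x‖) (volume.restrict (closedBall c (6 * s))) :=
          (hωc.norm.aestronglyMeasurable measurableSet_closedBall).aemeasurable
        exact ((h1.mul h2).pow_const α).aestronglyMeasurable
      have hint : IntegrableOn (fun x => (m t x * ‖curl (u t) x‖) ^ α) (closedBall c (6 * s)) := by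
        refine IntegrableOn.of_bound measure_closedBall_lt_top hmeas ((Mb * Bω) ^ α) ?_
        refine (ae_restrict_mem measurableSet_closedBall).mono fun x hx => ?_
        rw [Real.norm_of_nonneg (Real.rpow_nonneg (mul_nonneg (hm0' t x) (norm_nonneg _)) _)]
        exact Real.rpow_le_rpow (mul_nonneg (hm0' t x) (norm_nonneg _))
          (mul_le_mul (hMb x) (hBω x hx) (norm_nonneg _) hMb0) hα0.le
      have e1 : ENNReal.ofReal (∫ x in closedBall c (6 * s), (m t x * ‖curl (u t) x‖) ^ α) =
          ∫⁻ x in closedBall c (6 * s), ENNReal.ofReal ((m t x * ‖curl (u t) x‖) ^ α) :=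
        ofReal_integral_eq_lintegral_ofReal hint (ae_of_all _ fun x =>
          Real.rpow_nonneg (mul_nonneg (hm0' t x) (norm_nonneg _)) _)
      have e2 : ∀ x ∈ closedBall c (6 * s), ENNReal.ofReal ((m t x * ‖curl (u t) x‖) ^ α) ≤
          ‖curl (u t) x‖ₑ ^ α * GrujicGuberovic2010.coherenceQuotient γ (2 * R) u t x ^ α := by
        intro x hx
        have hxU : x ∈ ball x₀ (2 * R) := h6cU hx
        have hmx : ENNReal.ofReal (m t x) ≤ GrujicGuberovic2010.coherenceQuotient γ (2 * R) u t x := by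
          simp only [hmdef]
          by_cases hx' : x ∈ {y : EuclideanSpace ℝ (Fin 3) | y ∈ ball x₀ (3 * R / 2) ∧ (1 : ℝ) < ‖curl (u t) y‖}
          · rw [indicator_of_mem hx']
            simp only [hρU, indicator_of_mem hxU]
            exact ENNReal.ofReal_toReal_le
          · rw [indicator_of_notMem hx', ENNReal.ofReal_zero]; exact zero_le
        rw [← ENNReal.ofReal_rpow_of_nonneg (mul_nonneg (hm0' t x) (norm_nonneg _)) hα0.le,
          ENNReal.ofReal_mul (hm0' t x), ofReal_norm, ENNReal.mul_rpow_of_nonneg _ _ hα0.le, mul_comm]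
        exact mul_le_mul' le_rfl (ENNReal.rpow_le_rpow hmx hα0.le)
      have hmono : ∫⁻ x in closedBall c (6 * s), ENNReal.ofReal ((m t x * ‖curl (u t) x‖) ^ α) ≤
          ∫⁻ x in ball x₀ (2 * R), ‖curl (u t) x‖ₑ ^ α *
            GrujicGuberovic2010.coherenceQuotient γ (2 * R) u t x ^ α :=
        (setLIntegral_mono' measurableSet_closedBall e2).trans (lintegral_mono_set h6cU)
      show ENNReal.ofReal ((∫ x in closedBall c (6 * s), (m t x * ‖curl (u t) x‖) ^ α) ^ (1 / (α * θ))) ≤ H t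
      rw [he, ← ENNReal.ofReal_rpow_of_nonneg (hNWI0 t) he0, e1, hHdef]
      exact ENNReal.rpow_le_rpow hmono he0
    -- ### the lower integral of the coefficient is finite
    set ah : ℝ → ℝ≥0∞ := fun t => ENNReal.ofReal (acoef t) with hahdef
    have hah_le : ∀ t ∈ I, ah t ≤ ENNReal.ofReal (αc t) + ENNReal.ofReal A₂ * H t := by
      intro t ht
      show ENNReal.ofReal (αc t + A₂ * NW t) ≤ _
      rw [ENNReal.ofReal_add (hαc0 t) (mul_nonneg hA₂ (hNW0 t)), ENNReal.ofReal_mul hA₂]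
      exact add_le_add le_rfl (mul_le_mul' le_rfl (hNWH t ht))
    have hAfin : ∫⁻ t in Ico a t₀, ah t ≠ ⊤ := by
      have h1 : ∫⁻ t in Ico a t₀, ENNReal.ofReal (αc t) < ⊤ := by
        refine lt_of_le_of_lt (lintegral_mono fun t => ?_) hαci.2
        exact (Real.enorm_eq_ofReal (hαc0 t)).symm.le
      have h2 : ∫⁻ t in Ico a t₀, ENNReal.ofReal A₂ * H t < ⊤ := by
        rw [lintegral_const_mul' _ _ ENNReal.ofReal_ne_top]
        exact ENNReal.mul_lt_top ENNReal.ofReal_lt_top hHint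
      have hαcm : AEMeasurable (fun t => ENNReal.ofReal (αc t)) (volume.restrict (Ico a t₀)) :=
        ((hαcc.mono haI).aestronglyMeasurable hIco_meas).aemeasurable.ennreal_ofReal
      have h3 : ∫⁻ t in Ico a t₀, ah t ≤
          (∫⁻ t in Ico a t₀, ENNReal.ofReal (αc t)) + ∫⁻ t in Ico a t₀, ENNReal.ofReal A₂ * H t := by
        rw [← lintegral_add_left' hαcm]
        exact setLIntegral_mono' hIco_meas fun t ht => hah_le t (haI ht)
      exact ne_top_of_le_ne_top (ENNReal.add_lt_top.2 ⟨h1, h2⟩).ne h3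
    -- ### the integral inequality `y(τ) ≤ B + ∫ a y`
    have hyc : ContinuousOn y I := fun t ht => (hder t ht).continuousAt.continuousWithinAt
    set Btot : ℝ := y a + ∫ s' in Ico a t₀, β s' with hBtotdef
    have hBtot0 : 0 ≤ Btot := add_nonneg (hy0 a) (setIntegral_nonneg hIco_meas fun t _ => hβ0 t)
    have hineq : ∀ τ ∈ Ico a t₀, ENNReal.ofReal (y τ) ≤
        ENNReal.ofReal Btot + ∫⁻ s' in Ioo a τ, ah s' * ENNReal.ofReal (y s') := by
      intro τ hτ
      have hIcc : Icc a τ ⊆ I := fun t ht => haI ⟨ht.1, ht.2.trans_lt hτ.2⟩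
      have hsubτ : Ioc a τ ⊆ Ico a t₀ := fun t ht => ⟨ht.1.le, ht.2.trans_lt hτ.2⟩
      -- fundamental theorem of calculus for `y`
      have hDi : IntervalIntegrable D volume a τ :=
        (hDc.mono (by rw [uIcc_of_le hτ.1]; exact hIcc)).intervalIntegrable
      have hftc := intervalIntegral.integral_eq_sub_of_hasDerivAt
        (fun t ht => hder t (hIcc (by rw [uIcc_of_le hτ.1] at ht; exact ht))) hDi
      rw [intervalIntegral.integral_of_le hτ.1] at hftc
      -- split `D = (D − β) + β`
      have hDI : IntegrableOn D (Ioc a τ) :=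
        ((hDc.mono hIcc).integrableOn_compact isCompact_Icc).mono_set Ioc_subset_Icc_self
      have hβI : IntegrableOn β (Ioc a τ) := hβi.mono_set hsubτ
      have hsplit : ∫ t in Ioc a τ, D t = (∫ t in Ioc a τ, (D t - β t)) + ∫ t in Ioc a τ, β t := by
        rw [integral_sub hDI hβI]; ring
      -- the positive part of `D − β` is below `a y`
      have hpos : IntegrableOn (fun t => max (D t - β t) 0) (Ioc a τ) := by
        have hsub' : ContinuousOn (fun t => D t - β t) (Icc a τ) :=
          (hDc.mono hIcc).sub (hβc.mono hIcc)
        have hc : ContinuousOn (fun t => max (D t - β t) 0) (Icc a τ) :=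
          ContinuousOn.sup hsub' continuousOn_const
        exact (hc.integrableOn_compact isCompact_Icc).mono_set Ioc_subset_Icc_self
      have h1 : ∫ t in Ioc a τ, (D t - β t) ≤ ∫ t in Ioc a τ, max (D t - β t) 0 :=
        setIntegral_mono_on (hDI.sub hβI) hpos measurableSet_Ioc fun t _ => le_max_left _ _
      have h2 : ENNReal.ofReal (∫ t in Ioc a τ, max (D t - β t) 0) ≤
          ∫⁻ t in Ioc a τ, ah t * ENNReal.ofReal (y t) := by
        rw [ofReal_integral_eq_lintegral_ofReal hpos (ae_of_all _ fun t => le_max_right _ _)]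
        refine setLIntegral_mono' measurableSet_Ioc fun t ht => ?_
        have htI : t ∈ I := haI (hsubτ ht)
        rw [hahdef, ← ENNReal.ofReal_mul (hacoef0 t)]
        refine ENNReal.ofReal_le_ofReal (max_le ?_ (mul_nonneg (hacoef0 t) (hy0 t)))
        linarith [hle' t htI]
      have h3 : ∫ t in Ioc a τ, β t ≤ ∫ t in Ico a t₀, β t :=
        setIntegral_mono_set hβi (ae_restrict_of_forall_mem hIco_meas fun t _ => hβ0 t)
          (ae_of_all _ hsubτ)
      have h4 : y τ ≤ Btot + ∫ t in Ioc a τ, max (D t - β t) 0 := by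
        have : y τ = y a + ∫ t in Ioc a τ, D t := by linarith
        rw [this, hsplit, hBtotdef]
        linarith
      have h5 : 0 ≤ ∫ t in Ioc a τ, max (D t - β t) 0 :=
        setIntegral_nonneg measurableSet_Ioc fun t _ => le_max_right _ _
      calc ENNReal.ofReal (y τ) ≤ ENNReal.ofReal (Btot + ∫ t in Ioc a τ, max (D t - β t) 0) :=
            ENNReal.ofReal_le_ofReal h4
        _ = ENNReal.ofReal Btot + ENNReal.ofReal (∫ t in Ioc a τ, max (D t - β t) 0) :=
            ENNReal.ofReal_add hBtot0 h5
        _ ≤ ENNReal.ofReal Btot + ∫⁻ t in Ioc a τ, ah t * ENNReal.ofReal (y t) :=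
            add_le_add le_rfl h2
        _ = ENNReal.ofReal Btot + ∫⁻ t in Ioo a τ, ah t * ENNReal.ofReal (y t) := by
            rw [setLIntegral_congr Ioo_ae_eq_Ioc]
    -- ### Grönwall
    set Cfin : ℝ := Btot * Real.exp ((∫⁻ s' in Ico a t₀, ah s').toReal) with hCfin
    have hgr : ∀ τ ∈ Ico a t₀, y τ ≤ Cfin := by
      intro τ hτ
      have hIcc : Icc a τ ⊆ I := fun t ht => haI ⟨ht.1, ht.2.trans_lt hτ.2⟩
      obtain ⟨By, hBy⟩ := isCompact_Icc.exists_bound_of_continuousOn (hyc.mono hIcc)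
      have hsub : Ioo a τ ⊆ Ico a t₀ := fun t ht => ⟨ht.1.le, ht.2.trans hτ.2⟩
      have haτ : ∫⁻ t in Ioo a τ, ah t ≠ ⊤ :=
        ne_top_of_le_ne_top hAfin (lintegral_mono_set hsub)
      have hG := SereginZajaczkowski2007.lintegral_gronwall_le_of_Icc (T₀ := a) (T₁ := τ)
        (φ := fun t => ENNReal.ofReal (y t)) (a := ah) (B := ENNReal.ofReal Btot)
        (M := ENNReal.ofReal By) ENNReal.ofReal_ne_top ENNReal.ofReal_ne_top
        (fun t ht => ENNReal.ofReal_le_ofReal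
          ((le_abs_self _).trans ((Real.norm_eq_abs _).symm.le.trans (hBy t ht))))
        haτ (fun t ht => hineq t ⟨ht.1, ht.2.trans_lt hτ.2⟩) τ ⟨hτ.1, le_rfl⟩
      have hexp : Real.exp ((∫⁻ s' in Ioo a τ, ah s').toReal) ≤
          Real.exp ((∫⁻ s' in Ico a t₀, ah s').toReal) :=
        Real.exp_le_exp.2 (ENNReal.toReal_mono hAfin (lintegral_mono_set hsub))
      have h2 : ENNReal.ofReal (y τ) ≤ ENNReal.ofReal Cfin := by
        rw [hCfin, ENNReal.ofReal_mul hBtot0]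
        exact hG.trans (mul_le_mul' le_rfl (ENNReal.ofReal_le_ofReal hexp))
      exact (ENNReal.ofReal_le_ofReal_iff (by positivity)).1 h2
    refine ⟨Cfin, fun t ht => ?_⟩
    have htI : t ∈ Ico a t₀ := ⟨by have := ht.1; nlinarith, ht.2⟩
    refine le_trans ?_ (hgr t htI)
    -- `∫_{B(c, s/2)} |ω|² ≤ ∫ φ²|ω|²`
    have hωc : ContinuousOn (fun x => ‖curl (u t) x‖ ^ 2) S :=
      fun x hx => ((hslω t (haI htI) x hx).norm.pow 2)
    have hφS : tsupport φ ⊆ S := hφs.trans ((closedBall_subset_closedBall (by linarith)).trans hcS)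
    have hprod : Continuous fun x => φ x ^ 2 * ‖curl (u t) x‖ ^ 2 :=
      continuous_sq_mul_of_continuousOn_cw hS hφc hφS hωc
    have hsupp : HasCompactSupport φ :=
      (isCompact_closedBall c s).of_isClosed_subset (isClosed_tsupport φ) hφs
    have hint : Integrable fun x => φ x ^ 2 * ‖curl (u t) x‖ ^ 2 := by
      refine hprod.integrable_of_hasCompactSupport (hsupp.mono fun x hx => ?_)
      rw [mem_support] at hx ⊢
      intro h; exact hx (by rw [h]; ring)
    calc ∫ x in ball c (s / 2), ‖curl (u t) x‖ ^ 2
        = ∫ x in ball c (s / 2), φ x ^ 2 * ‖curl (u t) x‖ ^ 2 :=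
          setIntegral_congr_fun measurableSet_ball fun x hx => by rw [hφ1 x hx]; ring
      _ ≤ ∫ x, φ x ^ 2 * ‖curl (u t) x‖ ^ 2 :=
          setIntegral_le_integral hint (ae_of_all _ fun x => by positivity)
  -- ### the finite cover of `B̄(x₀, R)`
  obtain ⟨tc, htc, htcfin, hcover⟩ := finite_cover_balls_of_compact (isCompact_closedBall x₀ R)
    (e := s / 2) (by positivity)
  choose! Cb hCb using key
  refine ⟨∑ c ∈ htcfin.toFinset, Cb c, fun t ht => ?_⟩
  have htI : t ∈ I := ⟨by have := ht.1; nlinarith, ht.2⟩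
  have hωc : ContinuousOn (fun x => ‖curl (u t) x‖ ^ 2) S :=
    fun x hx => ((hslω t htI x hx).norm.pow 2)
  have hRS : closedBall x₀ R ⊆ S := fun x hx => by
    rw [mem_closedBall] at hx; rw [hSdef, mem_ball]; linarith
  have hintR : IntegrableOn (fun x => ‖curl (u t) x‖ ^ 2) (ball x₀ R) :=
    ((hωc.mono hRS).integrableOn_compact (isCompact_closedBall x₀ R)).mono_set ball_subset_closedBall
  have hintc : ∀ c ∈ htcfin.toFinset, IntegrableOn (fun x => ‖curl (u t) x‖ ^ 2) (ball c (s / 2)) := by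
    intro c hc
    have hc' : c ∈ closedBall x₀ R := htc (htcfin.mem_toFinset.1 hc)
    rw [mem_closedBall] at hc'
    have hsub : closedBall c (s / 2) ⊆ S := fun x hx => by
      rw [mem_closedBall] at hx; rw [hSdef, mem_ball]
      calc dist x x₀ ≤ dist x c + dist c x₀ := dist_triangle _ _ _
        _ < 2 * R := by rw [hsdef] at hx; linarith
    exact ((hωc.mono hsub).integrableOn_compact (isCompact_closedBall c (s / 2))).mono_set
      ball_subset_closedBall
  have hpt : ∀ x, (ball x₀ R).indicator (fun x => ‖curl (u t) x‖ ^ 2) x ≤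
      ∑ c ∈ htcfin.toFinset, (ball c (s / 2)).indicator (fun x => ‖curl (u t) x‖ ^ 2) x := by
    intro x
    by_cases hx : x ∈ ball x₀ R
    · rw [indicator_of_mem hx]
      obtain ⟨c, hc, hxc⟩ : ∃ c ∈ tc, x ∈ ball c (s / 2) := by
        have := hcover (ball_subset_closedBall hx)
        simpa only [mem_iUnion, exists_prop] using this
      have hcmem : c ∈ htcfin.toFinset := htcfin.mem_toFinset.2 hc
      refine le_trans (le_of_eq (indicator_of_mem hxc (fun x => ‖curl (u t) x‖ ^ 2)).symm) ?_
      exact Finset.single_le_sum (f := fun c => (ball c (s / 2)).indicator (fun x => ‖curl (u t) x‖ ^ 2) x)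
        (fun c _ => indicator_nonneg (fun y _ => by positivity) _) hcmem
    · rw [indicator_of_notMem hx]
      exact Finset.sum_nonneg fun c _ => indicator_nonneg (fun y _ => by positivity) _
  have hIind : Integrable fun x => (ball x₀ R).indicator (fun x => ‖curl (u t) x‖ ^ 2) x :=
    (integrable_indicator_iff measurableSet_ball).2 hintR
  have hIsum : Integrable fun x =>
      ∑ c ∈ htcfin.toFinset, (ball c (s / 2)).indicator (fun x => ‖curl (u t) x‖ ^ 2) x :=
    integrable_finsetSum _ fun c hc => (integrable_indicator_iff measurableSet_ball).2 (hintc c hc)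
  calc ∫ x in ball x₀ R, ‖curl (u t) x‖ ^ 2
      = ∫ x, (ball x₀ R).indicator (fun x => ‖curl (u t) x‖ ^ 2) x :=
        (integral_indicator measurableSet_ball).symm
    _ ≤ ∫ x, ∑ c ∈ htcfin.toFinset, (ball c (s / 2)).indicator (fun x => ‖curl (u t) x‖ ^ 2) x :=
        integral_mono hIind hIsum hpt
    _ = ∑ c ∈ htcfin.toFinset, ∫ x, (ball c (s / 2)).indicator (fun x => ‖curl (u t) x‖ ^ 2) x :=
        integral_finsetSum _ fun c hc => (integrable_indicator_iff measurableSet_ball).2 (hintc c hc)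
    _ = ∑ c ∈ htcfin.toFinset, ∫ x in ball c (s / 2), ‖curl (u t) x‖ ^ 2 :=
        Finset.sum_congr rfl fun c _ => integral_indicator measurableSet_ball
    _ ≤ ∑ c ∈ htcfin.toFinset, Cb c :=
        Finset.sum_le_sum fun c hc => hCb c (htc (htcfin.mem_toFinset.1 hc)) t ht

end Literature.Analysis.FluidPDE

end
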